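import Literature.Computability.Cryptography.WordRAMStructuredBlocks
import Literature.Computability.FineGrained.NegativeTriangleToAPSP
import HarnessLib

/-!
# Radius `≤₃` APSP (Abboud–Grandoni–Vassilevska Williams 2015, Thm. 1.1, the trivial direction): the word-RAM program

Abboud, Grandoni and Vassilevska Williams, *Subcubic equivalences between graph centrality problems,
APSP and diameter*, SODA 2015, Thm. 1.1: Radius and APSP are equivalent under subcubic reductions;
"one direction is trivial" — compute all distances and read off `R* = min_v max_t d(v, t)` "doing a
negligible amount of post-processing". The prelude renders `≤₃` as `FGReducible` (VVW ICM 2018,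
Def. 2.1): the existence of a concrete deterministic word-RAM oracle program. This file writes the
trivial direction down as structured code (`SProg` of
`Literature.Computability.Cryptography.WordRAMStructured`) and proves the semantics of its phases;
the assembly into `FGReducible (Radius c) (n ↦ n³) (APSP c) (n ↦ n³)` is
`Literature.Computability.FineGrained.RadiusToAPSP`.

## The program `prog`

On the input `⌜W⌝` (`N`, then the `N²` codes of the weights; a `Radius c` instance has `N = n + 1`
vertices):

* `relocate` (the library bootstrap): the input lands verbatim at `D + 1, …, D + L` (`D = L + 100`,
  `L = N² + 1`), and cell `0` holds `D + 1` — so the APSP query *is* the relocated input;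
* `setupOps`: `N`, the query length `L`, the answer address `pR N = 2 N² + 103` and the base
  `pR N + 2` of the distance codes, the order key constants `A = 2 ^ w - 1` (all ones, `0 - 1`) and
  `Hf = A / 2`, and the registers of the outer loop (rows to go `N`, row pointer, running minimum
  `(A, 0)`);
* the oracle `query` (the input matrix), answer (`L`, then `⌜shortestDist W⌝`) at `pR N`;
* **the fold**: an outer loop over the rows `i` (`outerPre`, inner loop, `outerPost`) and an inner
  loop over the entries `j` (`keyOps`, `selOps`): `keyOps` reads the code `c = ⌜d(i, j)⌝` and computes
  the *order key* `keyOf A Hf c` — `A` for `c = 0 = ⌜⊤⌝`, and `Hf + z` for `c = ⌜z⌝` (zig-zag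
  decoding by parity arithmetic), an increasing recoding of `ℤ ∪ {⊤}` into words — without branches
  (the two candidates are blended by the indicator `[c = 0]`); `selOps` keeps the running row
  maximum of the keys together with the code attaining it, again branch-free
  (`bsel ℓ a b = a (1 - ℓ) + b ℓ` with `ℓ = [a < key]`); `outerPost` folds the row maximum into the
  running minimum the same way. The registers follow the pure recursions `rowSt`, `minSt`;
* `finishOps`: output `[code attaining the min of the row maxima]` — identified with
  `⌜weightedRadius W⌝` in `Literature.Computability.FineGrained.RadiusToAPSP`.

## Proof technique

Symbolic execution of straight-line blocks one operation at a time (`execOps_cons_fwd` with the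
`merge` register/data normaliser of `Literature.Computability.Cryptography.WordRAMStructuredBlocks`)
and the invariant loop rule `ExecLE.whilenz_invariant` (nested: the inner loop inside the body of
the outer loop), as in `Literature.Computability.FineGrained.MinPlusProductToAPSPProgram`.

## References

* A. Abboud, F. Grandoni, V. Vassilevska Williams, *Subcubic equivalences between graph centrality
  problems, APSP and diameter*, Proc. SODA 2015, 1681–1697, Thm. 1.1 ("one direction is trivial").
  doi:10.1137/1.9781611973730.112
* V. Vassilevska Williams, *On some fine-grained questions in algorithms and complexity*, Proc. ICM
  2018, §2, Def. 2.1 (fine-grained reductions on the word RAM).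
* T. Nipkow, G. Klein, *Concrete Semantics with Isabelle/HOL*, Springer 2014, §7, §12.
-/

namespace Literature.Computability.FineGrained.RadiusToAPSP

open Cryptography Cryptography.WordRAM Cryptography.WordRAM.SProg Matrix NegTriToAPSP

/-! ## Memory layout -/

/-- The answer cell for an `N × N` input: the oracle writes the answer's length `N² + 1` here, the
header `N` after it, and the code of the distance `d(i, j)` at `pR N + 2 + (i N + j)`. [folklore] -/
def pR (N : ℕ) : ℕ := 2 * (N * N) + 103
/-- The first cell above everything the program touches. [folklore] -/
def pTop (N : ℕ) : ℕ := 3 * (N * N) + 107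

/-- `pR N = 2 N² + 103`. [folklore] -/
theorem pR_eq (N : ℕ) : pR N = 2 * (N * N) + 103 := rfl
/-- `pTop N = 3 N² + 107`. [folklore] -/
theorem pTop_eq (N : ℕ) : pTop N = 3 * (N * N) + 107 := rfl

/-! ## The order key and the folds (pure) -/

/-- **The order key of a code**: `A` (all ones) for the code `0` of `⊤`, and
`Hf + k / 2 - (k mod 2) · k` for the code `k + 1` of the integer with zig-zag code `k` — i.e. `Hf + z`
for `⌜z⌝` (`keyOf_encode` in the assembly file): an increasing recoding of the bounded part of
`ℤ ∪ {⊤}` into words, computable by parity arithmetic. [folklore] -/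
def keyOf (A Hf c : ℕ) : ℕ := if c = 0 then A else Hf + (c - 1) / 2 - (c - 1) % 2 * (c - 1)

/-- **Branch-free select**: `bsel ℓ a b = a (1 - ℓ) + b ℓ` is `b` if `ℓ = 1` and `a` if `ℓ = 0`.
[folklore] -/
def bsel (l a b : ℕ) : ℕ := a * (1 - l) + b * l

/-- `bsel 0 a b = a`. [folklore] -/
@[simp] theorem bsel_zero (a b : ℕ) : bsel 0 a b = a := by simp [bsel]
/-- `bsel 1 a b = b`. [folklore] -/
@[simp] theorem bsel_one (a b : ℕ) : bsel 1 a b = b := by simp [bsel]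

/-- `bsel` by an indicator is the conditional. [folklore] -/
theorem bsel_ite (P : Prop) [Decidable P] (a b : ℕ) : bsel (if P then 1 else 0) a b = if P then b else a := by
  split_ifs <;> simp

/-- **The row fold**: the state `(running maximum of the keys, code attaining it)` after the first
`j` entries of row `i` of the code table `cd` (row-major, `N` columns), starting from `(0, 0)` and
updated on a *strictly* larger key. [folklore] -/
def rowSt (cd : ℕ → ℕ) (A Hf N i : ℕ) : ℕ → ℕ × ℕ
  | 0 => (0, 0)
  | j + 1 =>
    (bsel (if (rowSt cd A Hf N i j).1 < keyOf A Hf (cd (i * N + j)) then 1 else 0)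
        (rowSt cd A Hf N i j).1 (keyOf A Hf (cd (i * N + j))),
      bsel (if (rowSt cd A Hf N i j).1 < keyOf A Hf (cd (i * N + j)) then 1 else 0)
        (rowSt cd A Hf N i j).2 (cd (i * N + j)))

/-- **The column fold**: the state `(running minimum of the row maxima, code attaining it)` after
the first `r` rows, starting from `(A, 0)` and updated on a *strictly* smaller row maximum.
[folklore] -/
def minSt (cd : ℕ → ℕ) (A Hf N : ℕ) : ℕ → ℕ × ℕ
  | 0 => (A, 0)
  | r + 1 =>
    (bsel (if (rowSt cd A Hf N r N).1 < (minSt cd A Hf N r).1 then 1 else 0)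
        (minSt cd A Hf N r).1 (rowSt cd A Hf N r N).1,
      bsel (if (rowSt cd A Hf N r N).1 < (minSt cd A Hf N r).1 then 1 else 0)
        (minSt cd A Hf N r).2 (rowSt cd A Hf N r N).2)

/-- The row fold, one step, as a conditional. [folklore] -/
theorem rowSt_succ (cd : ℕ → ℕ) (A Hf N i j : ℕ) :
    rowSt cd A Hf N i (j + 1) =
      if (rowSt cd A Hf N i j).1 < keyOf A Hf (cd (i * N + j)) then (keyOf A Hf (cd (i * N + j)), cd (i * N + j))
      else rowSt cd A Hf N i j := by
  rw [rowSt]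
  split_ifs <;> simp

/-- The column fold, one step, as a conditional. [folklore] -/
theorem minSt_succ (cd : ℕ → ℕ) (A Hf N r : ℕ) :
    minSt cd A Hf N (r + 1) =
      if (rowSt cd A Hf N r N).1 < (minSt cd A Hf N r).1 then rowSt cd A Hf N r N else minSt cd A Hf N r := by
  rw [minSt]
  split_ifs <;> simp

/-- An indicator is `≤ 1`. [folklore] -/
theorem ite_le_one (P : Prop) [Decidable P] : (if P then 1 else 0 : ℕ) ≤ 1 := by split_ifs <;> omega

/-- A blend of two values `≤ A` is `≤ A`. [folklore] -/
theorem bsel_le {l a b A : ℕ} (hl : l ≤ 1) (ha : a ≤ A) (hb : b ≤ A) : bsel l a b ≤ A := by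
  rcases Nat.le_one_iff_eq_zero_or_eq_one.1 hl with rfl | rfl <;> simpa

/-- `a (1 - ℓ) ≤ a`, `b ℓ ≤ b` for an indicator `ℓ`. [folklore] -/
theorem mul_ind_le {l : ℕ} (hl : l ≤ 1) (a b : ℕ) : a * (1 - l) ≤ a ∧ b * l ≤ b := by
  rcases Nat.le_one_iff_eq_zero_or_eq_one.1 hl with rfl | rfl <;> simp

/-- The order key of a code `c ≤ Hf` is at most `A` (`2 Hf ≤ A`). [folklore] -/
theorem keyOf_le {A Hf c : ℕ} (hc : c ≤ Hf) (hHf : 2 * Hf ≤ A) : keyOf A Hf c ≤ A := by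
  unfold keyOf; split_ifs <;> omega

/-- The row fold stays below `A`. [folklore] -/
theorem rowSt_le {cd : ℕ → ℕ} {A Hf N : ℕ} (hcd : ∀ t, cd t ≤ Hf) (hHf : 2 * Hf ≤ A) (i : ℕ) :
    ∀ j, (rowSt cd A Hf N i j).1 ≤ A ∧ (rowSt cd A Hf N i j).2 ≤ A
  | 0 => by simp [rowSt]
  | j + 1 => by
    obtain ⟨h1, h2⟩ := rowSt_le hcd hHf i j
    rw [rowSt]
    exact ⟨bsel_le (ite_le_one _) h1 (keyOf_le (hcd _) hHf),
      bsel_le (ite_le_one _) h2 (by have := hcd (i * N + j); omega)⟩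

/-- The column fold stays below `A`. [folklore] -/
theorem minSt_le {cd : ℕ → ℕ} {A Hf N : ℕ} (hcd : ∀ t, cd t ≤ Hf) (hHf : 2 * Hf ≤ A) :
    ∀ r, (minSt cd A Hf N r).1 ≤ A ∧ (minSt cd A Hf N r).2 ≤ A
  | 0 => by simp [minSt]
  | r + 1 => by
    obtain ⟨h1, h2⟩ := minSt_le hcd hHf r
    obtain ⟨h3, h4⟩ := rowSt_le hcd hHf r N
    rw [minSt]
    exact ⟨bsel_le (ite_le_one _) h1 h3, bsel_le (ite_le_one _) h2 h4⟩

/-! ## The program -/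

/-- The setup block (after `relocate`; cell `1` holds `D = N² + 101`, cell `D` holds `N`, cell `0`
holds `D + 1`, the query address): `r2 := N`, `r3 := N²`, `r4 := N² + 1` (query length),
`r6 := pR N`, `r7 := pR N + 2`, `r8 := A = 0 - 1` (all ones), `r9 := Hf = A / 2`, and the outer
loop's registers `r20 := N` (rows to go), `r21 := pR N + 2` (row pointer), `r22 := A`, `r23 := 0`
(running minimum and its code). [folklore] -/
def setupOps : List OpSpec :=
  [(.add, .dir 2, .ind 1, .imm 0), (.mul, .dir 3, .dir 2, .dir 2), (.add, .dir 4, .dir 3, .imm 1),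
    (.add, .dir 6, .dir 1, .dir 4), (.add, .dir 6, .dir 6, .imm 1), (.add, .dir 7, .dir 6, .imm 2),
    (.sub, .dir 8, .imm 0, .imm 1), (.div, .dir 9, .dir 8, .imm 2),
    (.add, .dir 20, .dir 2, .imm 0), (.add, .dir 21, .dir 7, .imm 0), (.add, .dir 22, .dir 8, .imm 0),
    (.add, .dir 23, .imm 0, .imm 0)]

/-- **The key block** of the inner loop: read the code `c` at the entry pointer `r27` into `r30`
and compute its order key into `r39`: `iz := [c = 0]`, `k := c - 1`, `p := k mod 2`,
`t := Hf + k / 2 - p k` (the key of a finite weight; junk but harmless when `c = 0`),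
`key := A · iz + t · (1 - iz)`. [folklore] -/
def keyOps : List OpSpec :=
  [(.add, .dir 30, .ind 27, .imm 0), (.eq, .dir 31, .dir 30, .imm 0), (.sub, .dir 32, .dir 30, .imm 1),
    (.mod, .dir 33, .dir 32, .imm 2), (.div, .dir 34, .dir 32, .imm 2), (.add, .dir 35, .dir 9, .dir 34),
    (.mul, .dir 36, .dir 33, .dir 32), (.sub, .dir 37, .dir 35, .dir 36), (.sub, .dir 38, .imm 1, .dir 31),
    (.mul, .dir 37, .dir 37, .dir 38), (.mul, .dir 39, .dir 8, .dir 31), (.add, .dir 39, .dir 39, .dir 37)]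

/-- **The select block** of the inner loop: `ℓ := [mx < key]`, `mx := mx (1 - ℓ) + key ℓ`,
`mxcode := mxcode (1 - ℓ) + c ℓ` (registers `24, 25`), advance the entry pointer `r27`, count down
`r26`. [folklore] -/
def selOps : List OpSpec :=
  [(.lt, .dir 40, .dir 24, .dir 39), (.sub, .dir 41, .imm 1, .dir 40), (.mul, .dir 24, .dir 24, .dir 41),
    (.mul, .dir 42, .dir 39, .dir 40), (.add, .dir 24, .dir 24, .dir 42), (.mul, .dir 25, .dir 25, .dir 41),
    (.mul, .dir 42, .dir 30, .dir 40), (.add, .dir 25, .dir 25, .dir 42), (.add, .dir 27, .dir 27, .imm 1),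
    (.sub, .dir 26, .dir 26, .imm 1)]

/-- The body of the inner loop. [folklore] -/
def innerBody : SProg := seqs [block keyOps, block selOps]

/-- Opening an iteration of the outer loop: `mx := 0`, `mxcode := 0`, `r26 := N` entries to go,
entry pointer `r27 :=` row pointer. [folklore] -/
def outerPre : List OpSpec :=
  [(.add, .dir 24, .imm 0, .imm 0), (.add, .dir 25, .imm 0, .imm 0), (.add, .dir 26, .dir 2, .imm 0),
    (.add, .dir 27, .dir 21, .imm 0)]

/-- Closing an iteration of the outer loop: `ℓ := [mx < mn]`, `mn := mn (1 - ℓ) + mx ℓ`,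
`mncode := mncode (1 - ℓ) + mxcode ℓ` (registers `22, 23`), advance the row pointer by `N`, count
down the rows. [folklore] -/
def outerPost : List OpSpec :=
  [(.lt, .dir 40, .dir 24, .dir 22), (.sub, .dir 41, .imm 1, .dir 40), (.mul, .dir 22, .dir 22, .dir 41),
    (.mul, .dir 42, .dir 24, .dir 40), (.add, .dir 22, .dir 22, .dir 42), (.mul, .dir 23, .dir 23, .dir 41),
    (.mul, .dir 42, .dir 25, .dir 40), (.add, .dir 23, .dir 23, .dir 42), (.add, .dir 21, .dir 21, .dir 2),
    (.sub, .dir 20, .dir 20, .imm 1)]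

/-- The body of the outer loop: open, run the inner loop over the row, close. [folklore] -/
def outerBody : SProg := seqs [block outerPre, whilenz (.dir 26) innerBody, block outerPost]

/-- After the fold: output `[mncode]` (`mem[1] := mncode`, `mem[0] := 1`). [folklore] -/
def finishOps : List OpSpec := [(.add, .dir 1, .dir 23, .imm 0), (.add, .dir 0, .imm 1, .imm 0)]

/-- **The reduction program** Radius `≤₃` APSP (the trivial direction of Abboud–Grandoni–Vassilevska
Williams, SODA 2015, Thm. 1.1): relocate the input, set up, query the APSP oracle on the input
matrix, fold the distance matrix into `min_i max_j` through the order keys, output the code found.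
[cite: AbboudGrandoniVassilevskaWilliams2015, Thm. 1.1 ("one direction is trivial")] -/
def prog : SProg :=
  seqs [relocate, block setupOps, SProg.query (.dir 0) (.dir 4) (.dir 6), whilenz (.dir 20) outerBody,
    block finishOps]

/-- The compiled program is deterministic. [folklore] -/
theorem prog_isDeterministic : prog.toProgram.IsDeterministic := toProgram_isDeterministic _

/-! ## Registers -/

/-- **The layout registers** after the setup: `r0 = N² + 102` (the query address `D + 1`),
`r2 = N`, `r4 = N² + 1`, `r6 = pR N`, `r7 = pR N + 2`, `r8 = A`, `r9 = Hf`. [folklore] -/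
structure Regs (N A Hf : ℕ) (S : ℕ → ℕ) : Prop where
  r0 : S 0 = N * N + 102
  r2 : S 2 = N
  r4 : S 4 = N * N + 1
  r6 : S 6 = pR N
  r7 : S 7 = pR N + 2
  r8 : S 8 = A
  r9 : S 9 = Hf

/-- **The outer loop's registers** after `r` rows: rows to go `r20 = N - r`, row pointer
`r21 = pR N + 2 + r N`, running minimum `(r22, r23) = minSt r`. [folklore] -/
structure ORegs (cd : ℕ → ℕ) (N A Hf r : ℕ) (S : ℕ → ℕ) : Prop where
  r20 : S 20 = N - r
  r21 : S 21 = pR N + 2 + r * N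
  r22 : S 22 = (minSt cd A Hf N r).1
  r23 : S 23 = (minSt cd A Hf N r).2

/-- **The inner loop's registers** in row `r` after `j` entries: running maximum
`(r24, r25) = rowSt r j`, entries to go `r26 = N - j`, entry pointer `r27 = pR N + 2 + r N + j`.
[folklore] -/
structure IRegs (cd : ℕ → ℕ) (N A Hf r j : ℕ) (S : ℕ → ℕ) : Prop where
  r24 : S 24 = (rowSt cd A Hf N r j).1
  r25 : S 25 = (rowSt cd A Hf N r j).2
  r26 : S 26 = N - j
  r27 : S 27 = pR N + 2 + r * N + j

/-- The layout registers survive any change above register `9`. [folklore] -/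
theorem Regs.of_agree {N A Hf : ℕ} {S S' : ℕ → ℕ} (h : Regs N A Hf S) (hag : ∀ q, q ≤ 9 → S' q = S q) :
    Regs N A Hf S' := by
  obtain ⟨h0, h2, h4, h6, h7, h8, h9⟩ := h
  exact ⟨(hag 0 (by norm_num)).trans h0, (hag 2 (by norm_num)).trans h2, (hag 4 (by norm_num)).trans h4,
    (hag 6 (by norm_num)).trans h6, (hag 7 (by norm_num)).trans h7, (hag 8 (by norm_num)).trans h8,
    (hag 9 (by norm_num)).trans h9⟩

/-- The outer registers survive any change outside `20, …, 23`. [folklore] -/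
theorem ORegs.of_agree {cd : ℕ → ℕ} {N A Hf r : ℕ} {S S' : ℕ → ℕ} (h : ORegs cd N A Hf r S)
    (hag : ∀ q, 20 ≤ q → q ≤ 23 → S' q = S q) : ORegs cd N A Hf r S' := by
  obtain ⟨h20, h21, h22, h23⟩ := h
  exact ⟨(hag 20 (by norm_num) (by norm_num)).trans h20, (hag 21 (by norm_num) (by norm_num)).trans h21,
    (hag 22 (by norm_num) (by norm_num)).trans h22, (hag 23 (by norm_num) (by norm_num)).trans h23⟩

/-! ## Exact arithmetic: all ones -/

/-- `0 - 1` is the all-ones word `2 ^ w - 1` (`w ≥ 1`). [folklore] -/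
theorem eval_sub_zero_one {w : ℕ} (hw : 1 ≤ w) : BinOp.sub.eval w 0 1 = 2 ^ w - 1 := by
  have h2 : 2 ≤ 2 ^ w := by
    calc (2 : ℕ) = 2 ^ 1 := by norm_num
      _ ≤ 2 ^ w := Nat.pow_le_pow_right (by norm_num) hw
  show (0 + 2 ^ w - 1 % 2 ^ w) % 2 ^ w = 2 ^ w - 1
  rw [Nat.mod_eq_of_lt (show 1 < 2 ^ w by omega), Nat.zero_add, Nat.mod_eq_of_lt (by omega)]

/-! ## The input and its relocation -/

section semantics

variable {N w : ℕ} {O : List ℕ → List ℕ} (W : Matrix (Fin N) (Fin N) (WithTop ℤ))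

/-- The input word list: the encoding of the weight matrix. [folklore] -/
def inp : List ℕ := encodeMatrixWithTop W

/-- The input has `N² + 1` words. [folklore] -/
theorem inp_length : (inp W).length = N * N + 1 := by
  unfold inp; rw [encodeMatrixWithTop_length, sq]

/-- Cell `0` of the relocated memory holds the query address `D + 1 = N² + 102`. [folklore] -/
theorem relocated_zero' : relocated (inp W) 0 = N * N + 102 := by
  rw [relocated_zero, inp_length]

/-- Cell `1` of the relocated memory holds `D = N² + 101`. [folklore] -/
theorem relocated_one' : relocated (inp W) 1 = N * N + 101 := by
  rw [relocated_one, inp_length]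

/-- Cell `D` of the relocated memory holds `N`. [folklore] -/
theorem relocated_D : relocated (inp W) (N * N + 101) = N := by
  have hlen := inp_length W
  have : N * N + 101 = (inp W).length + 100 := by rw [hlen]
  rw [this]
  unfold relocated
  rw [if_neg (by omega), if_neg (by omega), if_pos rfl, List.getD_eq_getElem _ _ (by rw [hlen]; omega)]
  exact getElem_encodeMatrixWithTop_zero _ _

/-- **The relocated input is the input**: the segment of length `L` at `D + 1` reads back `⌜W⌝`
(so the query on it is the APSP instance `W` itself). [folklore] -/
theorem readSeg_relocated : readSeg (relocated (inp W)) (N * N + 102) (N * N + 1) = inp W := by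
  have hlen := inp_length W
  refine readSeg_eq_of_forall hlen ?_
  intro j hj
  have : N * N + 102 + j = (inp W).length + 100 + (j + 1) := by rw [hlen]; omega
  rw [this, relocated_base_add _ (by omega) (by rw [hlen]; omega), Nat.add_sub_cancel,
    List.getD_eq_getElem _ _ (by rw [hlen]; exact hj)]

/-- Above the relocated input (from `pR N` on) the memory is `0`. [folklore] -/
theorem relocated_high {a : ℕ} (ha : pR N ≤ a) : relocated (inp W) a = 0 :=
  relocated_of_lt _ (by rw [inp_length]; rw [pR] at ha; omega)

/-! ## Setup -/

-- The symbolic execution below uses one uniform `simp only` read-normaliser per instruction;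
-- not every lemma of the set fires at every instruction.
set_option linter.unusedSimpArgs false in
/-- **The setup block**: the layout registers, the order key constants `A = 2 ^ w - 1`, `Hf = A / 2`,
and the outer loop's initial registers (`ORegs … 0`); the data is the relocated input. [folklore] -/
theorem setup_spec (cd : ℕ → ℕ) {A Hf : ℕ} (hw : 1 ≤ w) (hA : 2 ^ w - 1 = A) (hHf : A / 2 = Hf)
    (hF : pTop N < 2 ^ w) (qs : List (List ℕ)) :
    ∃ S : ℕ → ℕ, Exec w O (block setupOps) ⟨merge (relocated (inp W)) (relocated (inp W)), qs⟩
        ⟨merge S (relocated (inp W)), qs⟩ 12 ∧ Regs N A Hf S ∧ ORegs cd N A Hf 0 S := by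
  have hRR : pR N = 2 * (N * N) + 103 := rfl
  have hT : pTop N = 3 * (N * N) + 107 := rfl
  have h0 : relocated (inp W) 0 = N * N + 102 := relocated_zero' W
  have h1 : relocated (inp W) 1 = N * N + 101 := relocated_one' W
  have hDN : relocated (inp W) (N * N + 101) = N := relocated_D W
  have hnn : N ≤ N * N := Nat.le_mul_self N
  have hs01 : BinOp.sub.eval w 0 1 = A := by rw [eval_sub_zero_one hw, hA]
  have hAw : A < 2 ^ w := by omega
  have key : ∀ R, execOps w (merge (relocated (inp W)) (relocated (inp W))) setupOps = R →
      ∃ S : ℕ → ℕ, R = merge S (relocated (inp W)) ∧ Regs N A Hf S ∧ ORegs cd N A Hf 0 S := by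
    intro R hR
    unfold setupOps at hR
    have htmp := execOps_cons_fwd hR; clear hR; obtain ⟨v1, hv1, hR⟩ := htmp
    simp -failIfUnchanged (disch := omega) only [Operand.write, Operand.read, merge_apply_of_lt,
      merge_apply_of_le, Function.update_self, Function.update_of_ne, update_merge_of_lt,
      update_merge_of_le, Nat.add_zero, Nat.zero_add, BinOp.eval_mod, BinOp.eval_eq, BinOp.eval_band,
      BinOp.eval_shr, BinOp.eval_div, BinOp.eval_lt, BinOp.eval_add_of_lt, BinOp.eval_sub_of_le,
      BinOp.eval_mul_of_lt, h0, h1, hDN, hs01, hHf] at hv1 hR; subst hv1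
    have htmp := execOps_cons_fwd hR; clear hR; obtain ⟨v2, hv2, hR⟩ := htmp
    simp -failIfUnchanged (disch := omega) only [Operand.write, Operand.read, merge_apply_of_lt,
      merge_apply_of_le, Function.update_self, Function.update_of_ne, update_merge_of_lt,
      update_merge_of_le, Nat.add_zero, Nat.zero_add, BinOp.eval_mod, BinOp.eval_eq, BinOp.eval_band,
      BinOp.eval_shr, BinOp.eval_div, BinOp.eval_lt, BinOp.eval_add_of_lt, BinOp.eval_sub_of_le,
      BinOp.eval_mul_of_lt, h0, h1, hDN, hs01, hHf] at hv2 hR; subst hv2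
    have htmp := execOps_cons_fwd hR; clear hR; obtain ⟨v3, hv3, hR⟩ := htmp
    simp -failIfUnchanged (disch := omega) only [Operand.write, Operand.read, merge_apply_of_lt,
      merge_apply_of_le, Function.update_self, Function.update_of_ne, update_merge_of_lt,
      update_merge_of_le, Nat.add_zero, Nat.zero_add, BinOp.eval_mod, BinOp.eval_eq, BinOp.eval_band,
      BinOp.eval_shr, BinOp.eval_div, BinOp.eval_lt, BinOp.eval_add_of_lt, BinOp.eval_sub_of_le,
      BinOp.eval_mul_of_lt, h0, h1, hDN, hs01, hHf] at hv3 hR; subst hv3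
    have htmp := execOps_cons_fwd hR; clear hR; obtain ⟨v4, hv4, hR⟩ := htmp
    simp -failIfUnchanged (disch := omega) only [Operand.write, Operand.read, merge_apply_of_lt,
      merge_apply_of_le, Function.update_self, Function.update_of_ne, update_merge_of_lt,
      update_merge_of_le, Nat.add_zero, Nat.zero_add, BinOp.eval_mod, BinOp.eval_eq, BinOp.eval_band,
      BinOp.eval_shr, BinOp.eval_div, BinOp.eval_lt, BinOp.eval_add_of_lt, BinOp.eval_sub_of_le,
      BinOp.eval_mul_of_lt, h0, h1, hDN, hs01, hHf] at hv4 hR; subst hv4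
    have htmp := execOps_cons_fwd hR; clear hR; obtain ⟨v5, hv5, hR⟩ := htmp
    simp -failIfUnchanged (disch := omega) only [Operand.write, Operand.read, merge_apply_of_lt,
      merge_apply_of_le, Function.update_self, Function.update_of_ne, update_merge_of_lt,
      update_merge_of_le, Nat.add_zero, Nat.zero_add, BinOp.eval_mod, BinOp.eval_eq, BinOp.eval_band,
      BinOp.eval_shr, BinOp.eval_div, BinOp.eval_lt, BinOp.eval_add_of_lt, BinOp.eval_sub_of_le,
      BinOp.eval_mul_of_lt, h0, h1, hDN, hs01, hHf] at hv5 hR; subst hv5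
    have htmp := execOps_cons_fwd hR; clear hR; obtain ⟨v6, hv6, hR⟩ := htmp
    simp -failIfUnchanged (disch := omega) only [Operand.write, Operand.read, merge_apply_of_lt,
      merge_apply_of_le, Function.update_self, Function.update_of_ne, update_merge_of_lt,
      update_merge_of_le, Nat.add_zero, Nat.zero_add, BinOp.eval_mod, BinOp.eval_eq, BinOp.eval_band,
      BinOp.eval_shr, BinOp.eval_div, BinOp.eval_lt, BinOp.eval_add_of_lt, BinOp.eval_sub_of_le,
      BinOp.eval_mul_of_lt, h0, h1, hDN, hs01, hHf] at hv6 hR; subst hv6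
    have htmp := execOps_cons_fwd hR; clear hR; obtain ⟨v7, hv7, hR⟩ := htmp
    simp -failIfUnchanged (disch := omega) only [Operand.write, Operand.read, merge_apply_of_lt,
      merge_apply_of_le, Function.update_self, Function.update_of_ne, update_merge_of_lt,
      update_merge_of_le, Nat.add_zero, Nat.zero_add, BinOp.eval_mod, BinOp.eval_eq, BinOp.eval_band,
      BinOp.eval_shr, BinOp.eval_div, BinOp.eval_lt, BinOp.eval_add_of_lt, BinOp.eval_sub_of_le,
      BinOp.eval_mul_of_lt, h0, h1, hDN, hs01, hHf] at hv7 hR; subst hv7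
    have htmp := execOps_cons_fwd hR; clear hR; obtain ⟨v8, hv8, hR⟩ := htmp
    simp -failIfUnchanged (disch := omega) only [Operand.write, Operand.read, merge_apply_of_lt,
      merge_apply_of_le, Function.update_self, Function.update_of_ne, update_merge_of_lt,
      update_merge_of_le, Nat.add_zero, Nat.zero_add, BinOp.eval_mod, BinOp.eval_eq, BinOp.eval_band,
      BinOp.eval_shr, BinOp.eval_div, BinOp.eval_lt, BinOp.eval_add_of_lt, BinOp.eval_sub_of_le,
      BinOp.eval_mul_of_lt, h0, h1, hDN, hs01, hHf] at hv8 hR; subst hv8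
    have htmp := execOps_cons_fwd hR; clear hR; obtain ⟨v9, hv9, hR⟩ := htmp
    simp -failIfUnchanged (disch := omega) only [Operand.write, Operand.read, merge_apply_of_lt,
      merge_apply_of_le, Function.update_self, Function.update_of_ne, update_merge_of_lt,
      update_merge_of_le, Nat.add_zero, Nat.zero_add, BinOp.eval_mod, BinOp.eval_eq, BinOp.eval_band,
      BinOp.eval_shr, BinOp.eval_div, BinOp.eval_lt, BinOp.eval_add_of_lt, BinOp.eval_sub_of_le,
      BinOp.eval_mul_of_lt, h0, h1, hDN, hs01, hHf] at hv9 hR; subst hv9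
    have htmp := execOps_cons_fwd hR; clear hR; obtain ⟨v10, hv10, hR⟩ := htmp
    simp -failIfUnchanged (disch := omega) only [Operand.write, Operand.read, merge_apply_of_lt,
      merge_apply_of_le, Function.update_self, Function.update_of_ne, update_merge_of_lt,
      update_merge_of_le, Nat.add_zero, Nat.zero_add, BinOp.eval_mod, BinOp.eval_eq, BinOp.eval_band,
      BinOp.eval_shr, BinOp.eval_div, BinOp.eval_lt, BinOp.eval_add_of_lt, BinOp.eval_sub_of_le,
      BinOp.eval_mul_of_lt, h0, h1, hDN, hs01, hHf] at hv10 hR; subst hv10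
    have htmp := execOps_cons_fwd hR; clear hR; obtain ⟨v11, hv11, hR⟩ := htmp
    simp -failIfUnchanged (disch := omega) only [Operand.write, Operand.read, merge_apply_of_lt,
      merge_apply_of_le, Function.update_self, Function.update_of_ne, update_merge_of_lt,
      update_merge_of_le, Nat.add_zero, Nat.zero_add, BinOp.eval_mod, BinOp.eval_eq, BinOp.eval_band,
      BinOp.eval_shr, BinOp.eval_div, BinOp.eval_lt, BinOp.eval_add_of_lt, BinOp.eval_sub_of_le,
      BinOp.eval_mul_of_lt, h0, h1, hDN, hs01, hHf] at hv11 hR; subst hv11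
    have htmp := execOps_cons_fwd hR; clear hR; obtain ⟨v12, hv12, hR⟩ := htmp
    simp -failIfUnchanged (disch := omega) only [Operand.write, Operand.read, merge_apply_of_lt,
      merge_apply_of_le, Function.update_self, Function.update_of_ne, update_merge_of_lt,
      update_merge_of_le, Nat.add_zero, Nat.zero_add, BinOp.eval_mod, BinOp.eval_eq, BinOp.eval_band,
      BinOp.eval_shr, BinOp.eval_div, BinOp.eval_lt, BinOp.eval_add_of_lt, BinOp.eval_sub_of_le,
      BinOp.eval_mul_of_lt, h0, h1, hDN, hs01, hHf] at hv12 hR; subst hv12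
    simp only [execOps_nil] at hR; subst hR
    refine ⟨_, rfl, ⟨?_, ?_, ?_, ?_, ?_, ?_, ?_⟩, ⟨?_, ?_, ?_, ?_⟩⟩
    all_goals simp only [Function.update_self, Function.update_of_ne, ne_eq, Nat.reduceEqDiff,
      not_false_eq_true, h0, h1, minSt]
    all_goals omega
  obtain ⟨S, hR, hRg, hO⟩ := key _ rfl
  exact ⟨S, Exec.block' setupOps qs hR, hRg, hO⟩

/-! ## The inner loop -/

section inner

variable {cd : ℕ → ℕ} {A Hf CB : ℕ} {S H : ℕ → ℕ}

-- The symbolic execution below uses one uniform `simp only` read-normaliser per instruction;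
-- not every lemma of the set fires at every instruction.
set_option linter.unusedSimpArgs false in
/-- **The key block on a finite weight** (`c ≠ 0`): `r30 := c`, `r39 := keyOf A Hf c`, the
registers `≤ 29` and the data unchanged. [folklore] -/
theorem keyOps_spec_ne (hRg : Regs N A Hf S) {r j : ℕ} (hr : r < N) (hj : j < N)
    (h27 : S 27 = pR N + 2 + r * N + j) (hH : ∀ t, t < N * N → H (pR N + 2 + t) = cd t)
    (hcd : ∀ t, cd t ≤ CB) (hCB : CB ≤ Hf) (hHf : 2 * Hf ≤ A) (hAw : A < 2 ^ w) (hF : pTop N < 2 ^ w)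
    (hc0 : cd (r * N + j) ≠ 0) (qs : List (List ℕ)) :
    ∃ S', Exec w O (block keyOps) ⟨merge S H, qs⟩ ⟨merge S' H, qs⟩ 12 ∧ (∀ q, q ≤ 29 → S' q = S q) ∧
      S' 30 = cd (r * N + j) ∧ S' 39 = keyOf A Hf (cd (r * N + j)) := by
  have hRR : pR N = 2 * (N * N) + 103 := rfl
  have hT : pTop N = 3 * (N * N) + 107 := rfl
  have hNN : N ≤ N * N := Nat.le_mul_self N
  obtain ⟨h0, h2, h4, h6, h7, h8, h9⟩ := hRg
  have hrN : r * N + N ≤ N * N := by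
    have := Nat.mul_le_mul_right N (Nat.succ_le_of_lt hr); rwa [Nat.succ_mul] at this
  obtain ⟨c, hc⟩ : ∃ c, cd (r * N + j) = c := ⟨_, rfl⟩
  have hcB : c ≤ Hf := by rw [← hc]; exact (hcd _).trans hCB
  have hc1 : 1 ≤ c := by rw [← hc]; exact Nat.pos_of_ne_zero hc0
  have hc0' : ¬ c = 0 := by omega
  have hsrc : H (pR N + 2 + r * N + j) = c := by
    rw [Nat.add_assoc, hH _ (by omega), hc]
  obtain ⟨p, hp⟩ : ∃ p, (c - 1) % 2 = p := ⟨_, rfl⟩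
  have hp1 : p ≤ 1 := by omega
  obtain ⟨pk, hpk⟩ : ∃ pk, p * (c - 1) = pk := ⟨_, rfl⟩
  have hpkle : pk ≤ c - 1 := by
    rw [← hpk]; rcases Nat.le_one_iff_eq_zero_or_eq_one.1 hp1 with rfl | rfl <;> simp
  obtain ⟨key, hkey⟩ : ∃ key, Hf + (c - 1) / 2 - pk = key := ⟨_, rfl⟩
  have hkeyOf : keyOf A Hf c = key := by rw [keyOf, if_neg hc0', hp, hpk, hkey]
  have hiz : (if c = 0 then 1 else 0 : ℕ) = 0 := if_neg hc0'
  have step : ∀ R, execOps w (merge S H) keyOps = R →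
      ∃ S', R = merge S' H ∧ (∀ q, q ≤ 29 → S' q = S q) ∧ S' 30 = c ∧ S' 39 = key := by
    intro R hR
    unfold keyOps at hR
    have htmp := execOps_cons_fwd hR; clear hR; obtain ⟨v1, hv1, hR⟩ := htmp
    simp -failIfUnchanged (disch := omega) only [Operand.write, Operand.read, merge_apply_of_lt,
      merge_apply_of_le, Function.update_self, Function.update_of_ne, update_merge_of_lt,
      update_merge_of_le, Nat.add_zero, Nat.zero_add, BinOp.eval_mod, BinOp.eval_eq, BinOp.eval_band,
      BinOp.eval_shr, BinOp.eval_div, BinOp.eval_lt, BinOp.eval_add_of_lt, BinOp.eval_sub_of_le,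
      BinOp.eval_mul_of_lt, Nat.sub_self, Nat.sub_zero, Nat.mul_zero, Nat.zero_mul, Nat.mul_one, Nat.one_mul, h8, h9, h27, hsrc, hiz, hp, hpk, hkey] at hv1 hR; subst hv1
    have htmp := execOps_cons_fwd hR; clear hR; obtain ⟨v2, hv2, hR⟩ := htmp
    simp -failIfUnchanged (disch := omega) only [Operand.write, Operand.read, merge_apply_of_lt,
      merge_apply_of_le, Function.update_self, Function.update_of_ne, update_merge_of_lt,
      update_merge_of_le, Nat.add_zero, Nat.zero_add, BinOp.eval_mod, BinOp.eval_eq, BinOp.eval_band,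
      BinOp.eval_shr, BinOp.eval_div, BinOp.eval_lt, BinOp.eval_add_of_lt, BinOp.eval_sub_of_le,
      BinOp.eval_mul_of_lt, Nat.sub_self, Nat.sub_zero, Nat.mul_zero, Nat.zero_mul, Nat.mul_one, Nat.one_mul, h8, h9, h27, hsrc, hiz, hp, hpk, hkey] at hv2 hR; subst hv2
    have htmp := execOps_cons_fwd hR; clear hR; obtain ⟨v3, hv3, hR⟩ := htmp
    simp -failIfUnchanged (disch := omega) only [Operand.write, Operand.read, merge_apply_of_lt,
      merge_apply_of_le, Function.update_self, Function.update_of_ne, update_merge_of_lt,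
      update_merge_of_le, Nat.add_zero, Nat.zero_add, BinOp.eval_mod, BinOp.eval_eq, BinOp.eval_band,
      BinOp.eval_shr, BinOp.eval_div, BinOp.eval_lt, BinOp.eval_add_of_lt, BinOp.eval_sub_of_le,
      BinOp.eval_mul_of_lt, Nat.sub_self, Nat.sub_zero, Nat.mul_zero, Nat.zero_mul, Nat.mul_one, Nat.one_mul, h8, h9, h27, hsrc, hiz, hp, hpk, hkey] at hv3 hR; subst hv3
    have htmp := execOps_cons_fwd hR; clear hR; obtain ⟨v4, hv4, hR⟩ := htmp
    simp -failIfUnchanged (disch := omega) only [Operand.write, Operand.read, merge_apply_of_lt,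
      merge_apply_of_le, Function.update_self, Function.update_of_ne, update_merge_of_lt,
      update_merge_of_le, Nat.add_zero, Nat.zero_add, BinOp.eval_mod, BinOp.eval_eq, BinOp.eval_band,
      BinOp.eval_shr, BinOp.eval_div, BinOp.eval_lt, BinOp.eval_add_of_lt, BinOp.eval_sub_of_le,
      BinOp.eval_mul_of_lt, Nat.sub_self, Nat.sub_zero, Nat.mul_zero, Nat.zero_mul, Nat.mul_one, Nat.one_mul, h8, h9, h27, hsrc, hiz, hp, hpk, hkey] at hv4 hR; subst hv4
    have htmp := execOps_cons_fwd hR; clear hR; obtain ⟨v5, hv5, hR⟩ := htmp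
    simp -failIfUnchanged (disch := omega) only [Operand.write, Operand.read, merge_apply_of_lt,
      merge_apply_of_le, Function.update_self, Function.update_of_ne, update_merge_of_lt,
      update_merge_of_le, Nat.add_zero, Nat.zero_add, BinOp.eval_mod, BinOp.eval_eq, BinOp.eval_band,
      BinOp.eval_shr, BinOp.eval_div, BinOp.eval_lt, BinOp.eval_add_of_lt, BinOp.eval_sub_of_le,
      BinOp.eval_mul_of_lt, Nat.sub_self, Nat.sub_zero, Nat.mul_zero, Nat.zero_mul, Nat.mul_one, Nat.one_mul, h8, h9, h27, hsrc, hiz, hp, hpk, hkey] at hv5 hR; subst hv5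
    have htmp := execOps_cons_fwd hR; clear hR; obtain ⟨v6, hv6, hR⟩ := htmp
    simp -failIfUnchanged (disch := omega) only [Operand.write, Operand.read, merge_apply_of_lt,
      merge_apply_of_le, Function.update_self, Function.update_of_ne, update_merge_of_lt,
      update_merge_of_le, Nat.add_zero, Nat.zero_add, BinOp.eval_mod, BinOp.eval_eq, BinOp.eval_band,
      BinOp.eval_shr, BinOp.eval_div, BinOp.eval_lt, BinOp.eval_add_of_lt, BinOp.eval_sub_of_le,
      BinOp.eval_mul_of_lt, Nat.sub_self, Nat.sub_zero, Nat.mul_zero, Nat.zero_mul, Nat.mul_one, Nat.one_mul, h8, h9, h27, hsrc, hiz, hp, hpk, hkey] at hv6 hR; subst hv6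
    have htmp := execOps_cons_fwd hR; clear hR; obtain ⟨v7, hv7, hR⟩ := htmp
    simp -failIfUnchanged (disch := omega) only [Operand.write, Operand.read, merge_apply_of_lt,
      merge_apply_of_le, Function.update_self, Function.update_of_ne, update_merge_of_lt,
      update_merge_of_le, Nat.add_zero, Nat.zero_add, BinOp.eval_mod, BinOp.eval_eq, BinOp.eval_band,
      BinOp.eval_shr, BinOp.eval_div, BinOp.eval_lt, BinOp.eval_add_of_lt, BinOp.eval_sub_of_le,
      BinOp.eval_mul_of_lt, Nat.sub_self, Nat.sub_zero, Nat.mul_zero, Nat.zero_mul, Nat.mul_one, Nat.one_mul, h8, h9, h27, hsrc, hiz, hp, hpk, hkey] at hv7 hR; subst hv7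
    have htmp := execOps_cons_fwd hR; clear hR; obtain ⟨v8, hv8, hR⟩ := htmp
    simp -failIfUnchanged (disch := omega) only [Operand.write, Operand.read, merge_apply_of_lt,
      merge_apply_of_le, Function.update_self, Function.update_of_ne, update_merge_of_lt,
      update_merge_of_le, Nat.add_zero, Nat.zero_add, BinOp.eval_mod, BinOp.eval_eq, BinOp.eval_band,
      BinOp.eval_shr, BinOp.eval_div, BinOp.eval_lt, BinOp.eval_add_of_lt, BinOp.eval_sub_of_le,
      BinOp.eval_mul_of_lt, Nat.sub_self, Nat.sub_zero, Nat.mul_zero, Nat.zero_mul, Nat.mul_one, Nat.one_mul, h8, h9, h27, hsrc, hiz, hp, hpk, hkey] at hv8 hR; subst hv8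
    have htmp := execOps_cons_fwd hR; clear hR; obtain ⟨v9, hv9, hR⟩ := htmp
    simp -failIfUnchanged (disch := omega) only [Operand.write, Operand.read, merge_apply_of_lt,
      merge_apply_of_le, Function.update_self, Function.update_of_ne, update_merge_of_lt,
      update_merge_of_le, Nat.add_zero, Nat.zero_add, BinOp.eval_mod, BinOp.eval_eq, BinOp.eval_band,
      BinOp.eval_shr, BinOp.eval_div, BinOp.eval_lt, BinOp.eval_add_of_lt, BinOp.eval_sub_of_le,
      BinOp.eval_mul_of_lt, Nat.sub_self, Nat.sub_zero, Nat.mul_zero, Nat.zero_mul, Nat.mul_one, Nat.one_mul, h8, h9, h27, hsrc, hiz, hp, hpk, hkey] at hv9 hR; subst hv9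
    have htmp := execOps_cons_fwd hR; clear hR; obtain ⟨v10, hv10, hR⟩ := htmp
    simp -failIfUnchanged (disch := omega) only [Operand.write, Operand.read, merge_apply_of_lt,
      merge_apply_of_le, Function.update_self, Function.update_of_ne, update_merge_of_lt,
      update_merge_of_le, Nat.add_zero, Nat.zero_add, BinOp.eval_mod, BinOp.eval_eq, BinOp.eval_band,
      BinOp.eval_shr, BinOp.eval_div, BinOp.eval_lt, BinOp.eval_add_of_lt, BinOp.eval_sub_of_le,
      BinOp.eval_mul_of_lt, Nat.sub_self, Nat.sub_zero, Nat.mul_zero, Nat.zero_mul, Nat.mul_one, Nat.one_mul, h8, h9, h27, hsrc, hiz, hp, hpk, hkey] at hv10 hR; subst hv10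
    have htmp := execOps_cons_fwd hR; clear hR; obtain ⟨v11, hv11, hR⟩ := htmp
    simp -failIfUnchanged (disch := omega) only [Operand.write, Operand.read, merge_apply_of_lt,
      merge_apply_of_le, Function.update_self, Function.update_of_ne, update_merge_of_lt,
      update_merge_of_le, Nat.add_zero, Nat.zero_add, BinOp.eval_mod, BinOp.eval_eq, BinOp.eval_band,
      BinOp.eval_shr, BinOp.eval_div, BinOp.eval_lt, BinOp.eval_add_of_lt, BinOp.eval_sub_of_le,
      BinOp.eval_mul_of_lt, Nat.sub_self, Nat.sub_zero, Nat.mul_zero, Nat.zero_mul, Nat.mul_one, Nat.one_mul, h8, h9, h27, hsrc, hiz, hp, hpk, hkey] at hv11 hR; subst hv11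
    have htmp := execOps_cons_fwd hR; clear hR; obtain ⟨v12, hv12, hR⟩ := htmp
    simp -failIfUnchanged (disch := omega) only [Operand.write, Operand.read, merge_apply_of_lt,
      merge_apply_of_le, Function.update_self, Function.update_of_ne, update_merge_of_lt,
      update_merge_of_le, Nat.add_zero, Nat.zero_add, BinOp.eval_mod, BinOp.eval_eq, BinOp.eval_band,
      BinOp.eval_shr, BinOp.eval_div, BinOp.eval_lt, BinOp.eval_add_of_lt, BinOp.eval_sub_of_le,
      BinOp.eval_mul_of_lt, Nat.sub_self, Nat.sub_zero, Nat.mul_zero, Nat.zero_mul, Nat.mul_one, Nat.one_mul, h8, h9, h27, hsrc, hiz, hp, hpk, hkey] at hv12 hR; subst hv12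
    simp only [execOps_nil] at hR; subst hR
    refine ⟨_, rfl, fun q hq => ?_, ?_, ?_⟩
    · simp only [Function.update_of_ne (show q ≠ 30 by omega), Function.update_of_ne (show q ≠ 31 by omega), Function.update_of_ne (show q ≠ 32 by omega), Function.update_of_ne (show q ≠ 33 by omega), Function.update_of_ne (show q ≠ 34 by omega), Function.update_of_ne (show q ≠ 35 by omega), Function.update_of_ne (show q ≠ 36 by omega), Function.update_of_ne (show q ≠ 37 by omega), Function.update_of_ne (show q ≠ 38 by omega), Function.update_of_ne (show q ≠ 39 by omega)]
    all_goals simp only [Function.update_self, Function.update_of_ne, ne_eq, Nat.reduceEqDiff,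
      not_false_eq_true]
  obtain ⟨S', hR, hag, h30, h39⟩ := step _ rfl
  exact ⟨S', Exec.block' keyOps qs hR, hag, by rw [h30, hc], by rw [h39, hc, hkeyOf]⟩

-- The symbolic execution below uses one uniform `simp only` read-normaliser per instruction;
-- not every lemma of the set fires at every instruction.
set_option linter.unusedSimpArgs false in
/-- **The key block on `⊤`** (`c = 0`): `r30 := 0`, `r39 := A = keyOf A Hf 0` (the candidate key of
a finite weight is junk here but is blended out by `1 - [c = 0] = 0`). [folklore] -/
theorem keyOps_spec_zero (hRg : Regs N A Hf S) {r j : ℕ} (hr : r < N) (hj : j < N)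
    (h27 : S 27 = pR N + 2 + r * N + j) (hH : ∀ t, t < N * N → H (pR N + 2 + t) = cd t)
    (hHf : 2 * Hf ≤ A) (hw : 1 ≤ w) (hA : 2 ^ w - 1 = A) (hHfA : A / 2 = Hf) (hF : pTop N < 2 ^ w)
    (hc0 : cd (r * N + j) = 0) (qs : List (List ℕ)) :
    ∃ S', Exec w O (block keyOps) ⟨merge S H, qs⟩ ⟨merge S' H, qs⟩ 12 ∧ (∀ q, q ≤ 29 → S' q = S q) ∧
      S' 30 = cd (r * N + j) ∧ S' 39 = keyOf A Hf (cd (r * N + j)) := by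
  have hRR : pR N = 2 * (N * N) + 103 := rfl
  have hT : pTop N = 3 * (N * N) + 107 := rfl
  have hNN : N ≤ N * N := Nat.le_mul_self N
  obtain ⟨h0, h2, h4, h6, h7, h8, h9⟩ := hRg
  have hrN : r * N + N ≤ N * N := by
    have := Nat.mul_le_mul_right N (Nat.succ_le_of_lt hr); rwa [Nat.succ_mul] at this
  have hAw : A < 2 ^ w := by omega
  have hsrc : H (pR N + 2 + r * N + j) = 0 := by
    rw [Nat.add_assoc, hH _ (by omega), hc0]
  have hs01 : BinOp.sub.eval w 0 1 = A := by rw [eval_sub_zero_one hw, hA]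
  have hiz0 : (if (0 : ℕ) = 0 then 1 else 0 : ℕ) = 1 := if_pos rfl
  have step : ∀ R, execOps w (merge S H) keyOps = R →
      ∃ S', R = merge S' H ∧ (∀ q, q ≤ 29 → S' q = S q) ∧ S' 30 = 0 ∧ S' 39 = A := by
    intro R hR
    unfold keyOps at hR
    have htmp := execOps_cons_fwd hR; clear hR; obtain ⟨v1, hv1, hR⟩ := htmp
    simp -failIfUnchanged (disch := omega) only [Operand.write, Operand.read, merge_apply_of_lt,
      merge_apply_of_le, Function.update_self, Function.update_of_ne, update_merge_of_lt,
      update_merge_of_le, Nat.add_zero, Nat.zero_add, BinOp.eval_mod, BinOp.eval_eq, BinOp.eval_band,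
      BinOp.eval_shr, BinOp.eval_div, BinOp.eval_lt, BinOp.eval_add_of_lt, BinOp.eval_sub_of_le,
      BinOp.eval_mul_of_lt, Nat.sub_self, Nat.sub_zero, Nat.mul_zero, Nat.zero_mul, Nat.mul_one, Nat.one_mul, if_true, h8, h9, h27, hsrc, hiz0, hs01, hHfA] at hv1 hR; subst hv1
    have htmp := execOps_cons_fwd hR; clear hR; obtain ⟨v2, hv2, hR⟩ := htmp
    simp -failIfUnchanged (disch := omega) only [Operand.write, Operand.read, merge_apply_of_lt,
      merge_apply_of_le, Function.update_self, Function.update_of_ne, update_merge_of_lt,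
      update_merge_of_le, Nat.add_zero, Nat.zero_add, BinOp.eval_mod, BinOp.eval_eq, BinOp.eval_band,
      BinOp.eval_shr, BinOp.eval_div, BinOp.eval_lt, BinOp.eval_add_of_lt, BinOp.eval_sub_of_le,
      BinOp.eval_mul_of_lt, Nat.sub_self, Nat.sub_zero, Nat.mul_zero, Nat.zero_mul, Nat.mul_one, Nat.one_mul, if_true, h8, h9, h27, hsrc, hiz0, hs01, hHfA] at hv2 hR; subst hv2
    have htmp := execOps_cons_fwd hR; clear hR; obtain ⟨v3, hv3, hR⟩ := htmp
    simp -failIfUnchanged (disch := omega) only [Operand.write, Operand.read, merge_apply_of_lt,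
      merge_apply_of_le, Function.update_self, Function.update_of_ne, update_merge_of_lt,
      update_merge_of_le, Nat.add_zero, Nat.zero_add, BinOp.eval_mod, BinOp.eval_eq, BinOp.eval_band,
      BinOp.eval_shr, BinOp.eval_div, BinOp.eval_lt, BinOp.eval_add_of_lt, BinOp.eval_sub_of_le,
      BinOp.eval_mul_of_lt, Nat.sub_self, Nat.sub_zero, Nat.mul_zero, Nat.zero_mul, Nat.mul_one, Nat.one_mul, if_true, h8, h9, h27, hsrc, hiz0, hs01, hHfA] at hv3 hR; subst hv3
    have htmp := execOps_cons_fwd hR; clear hR; obtain ⟨v4, hv4, hR⟩ := htmp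
    simp -failIfUnchanged (disch := omega) only [Operand.write, Operand.read, merge_apply_of_lt,
      merge_apply_of_le, Function.update_self, Function.update_of_ne, update_merge_of_lt,
      update_merge_of_le, Nat.add_zero, Nat.zero_add, BinOp.eval_mod, BinOp.eval_eq, BinOp.eval_band,
      BinOp.eval_shr, BinOp.eval_div, BinOp.eval_lt, BinOp.eval_add_of_lt, BinOp.eval_sub_of_le,
      BinOp.eval_mul_of_lt, Nat.sub_self, Nat.sub_zero, Nat.mul_zero, Nat.zero_mul, Nat.mul_one, Nat.one_mul, if_true, h8, h9, h27, hsrc, hiz0, hs01, hHfA] at hv4 hR; subst hv4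
    have htmp := execOps_cons_fwd hR; clear hR; obtain ⟨v5, hv5, hR⟩ := htmp
    simp -failIfUnchanged (disch := omega) only [Operand.write, Operand.read, merge_apply_of_lt,
      merge_apply_of_le, Function.update_self, Function.update_of_ne, update_merge_of_lt,
      update_merge_of_le, Nat.add_zero, Nat.zero_add, BinOp.eval_mod, BinOp.eval_eq, BinOp.eval_band,
      BinOp.eval_shr, BinOp.eval_div, BinOp.eval_lt, BinOp.eval_add_of_lt, BinOp.eval_sub_of_le,
      BinOp.eval_mul_of_lt, Nat.sub_self, Nat.sub_zero, Nat.mul_zero, Nat.zero_mul, Nat.mul_one, Nat.one_mul, if_true, h8, h9, h27, hsrc, hiz0, hs01, hHfA] at hv5 hR; subst hv5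
    have htmp := execOps_cons_fwd hR; clear hR; obtain ⟨v6, hv6, hR⟩ := htmp
    simp -failIfUnchanged (disch := omega) only [Operand.write, Operand.read, merge_apply_of_lt,
      merge_apply_of_le, Function.update_self, Function.update_of_ne, update_merge_of_lt,
      update_merge_of_le, Nat.add_zero, Nat.zero_add, BinOp.eval_mod, BinOp.eval_eq, BinOp.eval_band,
      BinOp.eval_shr, BinOp.eval_div, BinOp.eval_lt, BinOp.eval_add_of_lt, BinOp.eval_sub_of_le,
      BinOp.eval_mul_of_lt, Nat.sub_self, Nat.sub_zero, Nat.mul_zero, Nat.zero_mul, Nat.mul_one, Nat.one_mul, if_true, h8, h9, h27, hsrc, hiz0, hs01, hHfA] at hv6 hR; subst hv6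
    have htmp := execOps_cons_fwd hR; clear hR; obtain ⟨v7, hv7, hR⟩ := htmp
    simp -failIfUnchanged (disch := omega) only [Operand.write, Operand.read, merge_apply_of_lt,
      merge_apply_of_le, Function.update_self, Function.update_of_ne, update_merge_of_lt,
      update_merge_of_le, Nat.add_zero, Nat.zero_add, BinOp.eval_mod, BinOp.eval_eq, BinOp.eval_band,
      BinOp.eval_shr, BinOp.eval_div, BinOp.eval_lt, BinOp.eval_add_of_lt, BinOp.eval_sub_of_le,
      BinOp.eval_mul_of_lt, Nat.sub_self, Nat.sub_zero, Nat.mul_zero, Nat.zero_mul, Nat.mul_one, Nat.one_mul, if_true, h8, h9, h27, hsrc, hiz0, hs01, hHfA] at hv7 hR; subst hv7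
    have htmp := execOps_cons_fwd hR; clear hR; obtain ⟨v8, hv8, hR⟩ := htmp
    simp -failIfUnchanged (disch := omega) only [Operand.write, Operand.read, merge_apply_of_lt,
      merge_apply_of_le, Function.update_self, Function.update_of_ne, update_merge_of_lt,
      update_merge_of_le, Nat.add_zero, Nat.zero_add, BinOp.eval_mod, BinOp.eval_eq, BinOp.eval_band,
      BinOp.eval_shr, BinOp.eval_div, BinOp.eval_lt, BinOp.eval_add_of_lt, BinOp.eval_sub_of_le,
      BinOp.eval_mul_of_lt, Nat.sub_self, Nat.sub_zero, Nat.mul_zero, Nat.zero_mul, Nat.mul_one, Nat.one_mul, if_true, h8, h9, h27, hsrc, hiz0, hs01, hHfA] at hv8 hR; subst hv8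
    have htmp := execOps_cons_fwd hR; clear hR; obtain ⟨v9, hv9, hR⟩ := htmp
    simp -failIfUnchanged (disch := omega) only [Operand.write, Operand.read, merge_apply_of_lt,
      merge_apply_of_le, Function.update_self, Function.update_of_ne, update_merge_of_lt,
      update_merge_of_le, Nat.add_zero, Nat.zero_add, BinOp.eval_mod, BinOp.eval_eq, BinOp.eval_band,
      BinOp.eval_shr, BinOp.eval_div, BinOp.eval_lt, BinOp.eval_add_of_lt, BinOp.eval_sub_of_le,
      BinOp.eval_mul_of_lt, Nat.sub_self, Nat.sub_zero, Nat.mul_zero, Nat.zero_mul, Nat.mul_one, Nat.one_mul, if_true, h8, h9, h27, hsrc, hiz0, hs01, hHfA] at hv9 hR; subst hv9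
    have htmp := execOps_cons_fwd hR; clear hR; obtain ⟨v10, hv10, hR⟩ := htmp
    simp -failIfUnchanged (disch := omega) only [Operand.write, Operand.read, merge_apply_of_lt,
      merge_apply_of_le, Function.update_self, Function.update_of_ne, update_merge_of_lt,
      update_merge_of_le, Nat.add_zero, Nat.zero_add, BinOp.eval_mod, BinOp.eval_eq, BinOp.eval_band,
      BinOp.eval_shr, BinOp.eval_div, BinOp.eval_lt, BinOp.eval_add_of_lt, BinOp.eval_sub_of_le,
      BinOp.eval_mul_of_lt, Nat.sub_self, Nat.sub_zero, Nat.mul_zero, Nat.zero_mul, Nat.mul_one, Nat.one_mul, if_true, h8, h9, h27, hsrc, hiz0, hs01, hHfA] at hv10 hR; subst hv10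
    have htmp := execOps_cons_fwd hR; clear hR; obtain ⟨v11, hv11, hR⟩ := htmp
    simp -failIfUnchanged (disch := omega) only [Operand.write, Operand.read, merge_apply_of_lt,
      merge_apply_of_le, Function.update_self, Function.update_of_ne, update_merge_of_lt,
      update_merge_of_le, Nat.add_zero, Nat.zero_add, BinOp.eval_mod, BinOp.eval_eq, BinOp.eval_band,
      BinOp.eval_shr, BinOp.eval_div, BinOp.eval_lt, BinOp.eval_add_of_lt, BinOp.eval_sub_of_le,
      BinOp.eval_mul_of_lt, Nat.sub_self, Nat.sub_zero, Nat.mul_zero, Nat.zero_mul, Nat.mul_one, Nat.one_mul, if_true, h8, h9, h27, hsrc, hiz0, hs01, hHfA] at hv11 hR; subst hv11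
    have htmp := execOps_cons_fwd hR; clear hR; obtain ⟨v12, hv12, hR⟩ := htmp
    simp -failIfUnchanged (disch := omega) only [Operand.write, Operand.read, merge_apply_of_lt,
      merge_apply_of_le, Function.update_self, Function.update_of_ne, update_merge_of_lt,
      update_merge_of_le, Nat.add_zero, Nat.zero_add, BinOp.eval_mod, BinOp.eval_eq, BinOp.eval_band,
      BinOp.eval_shr, BinOp.eval_div, BinOp.eval_lt, BinOp.eval_add_of_lt, BinOp.eval_sub_of_le,
      BinOp.eval_mul_of_lt, Nat.sub_self, Nat.sub_zero, Nat.mul_zero, Nat.zero_mul, Nat.mul_one, Nat.one_mul, if_true, h8, h9, h27, hsrc, hiz0, hs01, hHfA] at hv12 hR; subst hv12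
    simp only [execOps_nil] at hR; subst hR
    refine ⟨_, rfl, fun q hq => ?_, ?_, ?_⟩
    · simp only [Function.update_of_ne (show q ≠ 30 by omega), Function.update_of_ne (show q ≠ 31 by omega), Function.update_of_ne (show q ≠ 32 by omega), Function.update_of_ne (show q ≠ 33 by omega), Function.update_of_ne (show q ≠ 34 by omega), Function.update_of_ne (show q ≠ 35 by omega), Function.update_of_ne (show q ≠ 36 by omega), Function.update_of_ne (show q ≠ 37 by omega), Function.update_of_ne (show q ≠ 38 by omega), Function.update_of_ne (show q ≠ 39 by omega)]
    all_goals simp only [Function.update_self, Function.update_of_ne, ne_eq, Nat.reduceEqDiff,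
      not_false_eq_true]
  obtain ⟨S', hR, hag, h30, h39⟩ := step _ rfl
  exact ⟨S', Exec.block' keyOps qs hR, hag, by rw [h30, hc0], by rw [h39, hc0, keyOf, if_pos rfl]⟩

/-- **The key block**: `r30 := c`, `r39 := keyOf A Hf c` for the code `c` at the entry pointer.
[folklore] -/
theorem keyOps_spec (hRg : Regs N A Hf S) {r j : ℕ} (hr : r < N) (hj : j < N)
    (h27 : S 27 = pR N + 2 + r * N + j) (hH : ∀ t, t < N * N → H (pR N + 2 + t) = cd t)
    (hcd : ∀ t, cd t ≤ CB) (hCB : CB ≤ Hf) (hHf : 2 * Hf ≤ A) (hw : 1 ≤ w) (hA : 2 ^ w - 1 = A)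
    (hHfA : A / 2 = Hf) (hF : pTop N < 2 ^ w) (qs : List (List ℕ)) :
    ∃ S', Exec w O (block keyOps) ⟨merge S H, qs⟩ ⟨merge S' H, qs⟩ 12 ∧ (∀ q, q ≤ 29 → S' q = S q) ∧
      S' 30 = cd (r * N + j) ∧ S' 39 = keyOf A Hf (cd (r * N + j)) := by
  by_cases hc0 : cd (r * N + j) = 0
  · exact keyOps_spec_zero hRg hr hj h27 hH hHf hw hA hHfA hF hc0 qs
  · exact keyOps_spec_ne hRg hr hj h27 hH hcd hCB hHf (by omega) hF hc0 qs

-- The symbolic execution below uses one uniform `simp only` read-normaliser per instruction;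
-- not every lemma of the set fires at every instruction.
set_option linter.unusedSimpArgs false in
/-- **The select block**: with `r30 = c`, `r39 = key`, `(r24, r25) = (mx, mc)`, all `≤ A < 2 ^ w`,
it sets `(r24, r25) := (bsel ℓ mx key, bsel ℓ mc c)` with `ℓ = [mx < key]`, advances `r27` and
counts down `r26`; registers `≤ 23` unchanged. [folklore] -/
theorem selOps_spec {mx mc c key : ℕ} (h24 : S 24 = mx) (h25 : S 25 = mc) (h30 : S 30 = c)
    (h39 : S 39 = key) {j ptr : ℕ} (hj : j < N) (h26 : S 26 = N - j) (h27 : S 27 = ptr)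
    (hmx : mx ≤ A) (hmc : mc ≤ A) (hc : c ≤ A) (hkey : key ≤ A) (hAw : A < 2 ^ w) (hF : pTop N < 2 ^ w)
    (hptr : ptr < pTop N) (qs : List (List ℕ)) :
    ∃ S', Exec w O (block selOps) ⟨merge S H, qs⟩ ⟨merge S' H, qs⟩ 10 ∧ (∀ q, q ≤ 23 → S' q = S q) ∧
      S' 24 = bsel (if mx < key then 1 else 0) mx key ∧ S' 25 = bsel (if mx < key then 1 else 0) mc c ∧
      S' 26 = N - (j + 1) ∧ S' 27 = ptr + 1 := by
  have hT : pTop N = 3 * (N * N) + 107 := rfl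
  have hNN : N ≤ N * N := Nat.le_mul_self N
  obtain ⟨l, hl⟩ : ∃ l, (if mx < key then 1 else 0) = l := ⟨_, rfl⟩
  have hl1 : l ≤ 1 := by rw [← hl]; exact ite_le_one _
  obtain ⟨hm1, hm2⟩ := mul_ind_le hl1 mx key
  obtain ⟨hm3, hm4⟩ := mul_ind_le hl1 mc c
  have hs1 : mx * (1 - l) + key * l ≤ A := bsel_le hl1 hmx hkey
  have hs2 : mc * (1 - l) + c * l ≤ A := bsel_le hl1 hmc hc
  have step : ∀ R, execOps w (merge S H) selOps = R →
      ∃ S', R = merge S' H ∧ (∀ q, q ≤ 23 → S' q = S q) ∧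
        S' 24 = mx * (1 - l) + key * l ∧ S' 25 = mc * (1 - l) + c * l ∧ S' 26 = N - (j + 1) ∧ S' 27 = ptr + 1 := by
    intro R hR
    unfold selOps at hR
    have htmp := execOps_cons_fwd hR; clear hR; obtain ⟨v1, hv1, hR⟩ := htmp
    simp -failIfUnchanged (disch := omega) only [Operand.write, Operand.read, merge_apply_of_lt,
      merge_apply_of_le, Function.update_self, Function.update_of_ne, update_merge_of_lt,
      update_merge_of_le, Nat.add_zero, Nat.zero_add, BinOp.eval_mod, BinOp.eval_eq, BinOp.eval_band,
      BinOp.eval_shr, BinOp.eval_div, BinOp.eval_lt, BinOp.eval_add_of_lt, BinOp.eval_sub_of_le,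
      BinOp.eval_mul_of_lt, Nat.sub_self, Nat.sub_zero, Nat.mul_zero, Nat.zero_mul, Nat.mul_one, Nat.one_mul, h24, h25, h26, h27, h30, h39, hl] at hv1 hR; subst hv1
    have htmp := execOps_cons_fwd hR; clear hR; obtain ⟨v2, hv2, hR⟩ := htmp
    simp -failIfUnchanged (disch := omega) only [Operand.write, Operand.read, merge_apply_of_lt,
      merge_apply_of_le, Function.update_self, Function.update_of_ne, update_merge_of_lt,
      update_merge_of_le, Nat.add_zero, Nat.zero_add, BinOp.eval_mod, BinOp.eval_eq, BinOp.eval_band,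
      BinOp.eval_shr, BinOp.eval_div, BinOp.eval_lt, BinOp.eval_add_of_lt, BinOp.eval_sub_of_le,
      BinOp.eval_mul_of_lt, Nat.sub_self, Nat.sub_zero, Nat.mul_zero, Nat.zero_mul, Nat.mul_one, Nat.one_mul, h24, h25, h26, h27, h30, h39, hl] at hv2 hR; subst hv2
    have htmp := execOps_cons_fwd hR; clear hR; obtain ⟨v3, hv3, hR⟩ := htmp
    simp -failIfUnchanged (disch := omega) only [Operand.write, Operand.read, merge_apply_of_lt,
      merge_apply_of_le, Function.update_self, Function.update_of_ne, update_merge_of_lt,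
      update_merge_of_le, Nat.add_zero, Nat.zero_add, BinOp.eval_mod, BinOp.eval_eq, BinOp.eval_band,
      BinOp.eval_shr, BinOp.eval_div, BinOp.eval_lt, BinOp.eval_add_of_lt, BinOp.eval_sub_of_le,
      BinOp.eval_mul_of_lt, Nat.sub_self, Nat.sub_zero, Nat.mul_zero, Nat.zero_mul, Nat.mul_one, Nat.one_mul, h24, h25, h26, h27, h30, h39, hl] at hv3 hR; subst hv3
    have htmp := execOps_cons_fwd hR; clear hR; obtain ⟨v4, hv4, hR⟩ := htmp
    simp -failIfUnchanged (disch := omega) only [Operand.write, Operand.read, merge_apply_of_lt,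
      merge_apply_of_le, Function.update_self, Function.update_of_ne, update_merge_of_lt,
      update_merge_of_le, Nat.add_zero, Nat.zero_add, BinOp.eval_mod, BinOp.eval_eq, BinOp.eval_band,
      BinOp.eval_shr, BinOp.eval_div, BinOp.eval_lt, BinOp.eval_add_of_lt, BinOp.eval_sub_of_le,
      BinOp.eval_mul_of_lt, Nat.sub_self, Nat.sub_zero, Nat.mul_zero, Nat.zero_mul, Nat.mul_one, Nat.one_mul, h24, h25, h26, h27, h30, h39, hl] at hv4 hR; subst hv4
    have htmp := execOps_cons_fwd hR; clear hR; obtain ⟨v5, hv5, hR⟩ := htmp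
    simp -failIfUnchanged (disch := omega) only [Operand.write, Operand.read, merge_apply_of_lt,
      merge_apply_of_le, Function.update_self, Function.update_of_ne, update_merge_of_lt,
      update_merge_of_le, Nat.add_zero, Nat.zero_add, BinOp.eval_mod, BinOp.eval_eq, BinOp.eval_band,
      BinOp.eval_shr, BinOp.eval_div, BinOp.eval_lt, BinOp.eval_add_of_lt, BinOp.eval_sub_of_le,
      BinOp.eval_mul_of_lt, Nat.sub_self, Nat.sub_zero, Nat.mul_zero, Nat.zero_mul, Nat.mul_one, Nat.one_mul, h24, h25, h26, h27, h30, h39, hl] at hv5 hR; subst hv5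
    have htmp := execOps_cons_fwd hR; clear hR; obtain ⟨v6, hv6, hR⟩ := htmp
    simp -failIfUnchanged (disch := omega) only [Operand.write, Operand.read, merge_apply_of_lt,
      merge_apply_of_le, Function.update_self, Function.update_of_ne, update_merge_of_lt,
      update_merge_of_le, Nat.add_zero, Nat.zero_add, BinOp.eval_mod, BinOp.eval_eq, BinOp.eval_band,
      BinOp.eval_shr, BinOp.eval_div, BinOp.eval_lt, BinOp.eval_add_of_lt, BinOp.eval_sub_of_le,
      BinOp.eval_mul_of_lt, Nat.sub_self, Nat.sub_zero, Nat.mul_zero, Nat.zero_mul, Nat.mul_one, Nat.one_mul, h24, h25, h26, h27, h30, h39, hl] at hv6 hR; subst hv6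
    have htmp := execOps_cons_fwd hR; clear hR; obtain ⟨v7, hv7, hR⟩ := htmp
    simp -failIfUnchanged (disch := omega) only [Operand.write, Operand.read, merge_apply_of_lt,
      merge_apply_of_le, Function.update_self, Function.update_of_ne, update_merge_of_lt,
      update_merge_of_le, Nat.add_zero, Nat.zero_add, BinOp.eval_mod, BinOp.eval_eq, BinOp.eval_band,
      BinOp.eval_shr, BinOp.eval_div, BinOp.eval_lt, BinOp.eval_add_of_lt, BinOp.eval_sub_of_le,
      BinOp.eval_mul_of_lt, Nat.sub_self, Nat.sub_zero, Nat.mul_zero, Nat.zero_mul, Nat.mul_one, Nat.one_mul, h24, h25, h26, h27, h30, h39, hl] at hv7 hR; subst hv7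
    have htmp := execOps_cons_fwd hR; clear hR; obtain ⟨v8, hv8, hR⟩ := htmp
    simp -failIfUnchanged (disch := omega) only [Operand.write, Operand.read, merge_apply_of_lt,
      merge_apply_of_le, Function.update_self, Function.update_of_ne, update_merge_of_lt,
      update_merge_of_le, Nat.add_zero, Nat.zero_add, BinOp.eval_mod, BinOp.eval_eq, BinOp.eval_band,
      BinOp.eval_shr, BinOp.eval_div, BinOp.eval_lt, BinOp.eval_add_of_lt, BinOp.eval_sub_of_le,
      BinOp.eval_mul_of_lt, Nat.sub_self, Nat.sub_zero, Nat.mul_zero, Nat.zero_mul, Nat.mul_one, Nat.one_mul, h24, h25, h26, h27, h30, h39, hl] at hv8 hR; subst hv8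
    have htmp := execOps_cons_fwd hR; clear hR; obtain ⟨v9, hv9, hR⟩ := htmp
    simp -failIfUnchanged (disch := omega) only [Operand.write, Operand.read, merge_apply_of_lt,
      merge_apply_of_le, Function.update_self, Function.update_of_ne, update_merge_of_lt,
      update_merge_of_le, Nat.add_zero, Nat.zero_add, BinOp.eval_mod, BinOp.eval_eq, BinOp.eval_band,
      BinOp.eval_shr, BinOp.eval_div, BinOp.eval_lt, BinOp.eval_add_of_lt, BinOp.eval_sub_of_le,
      BinOp.eval_mul_of_lt, Nat.sub_self, Nat.sub_zero, Nat.mul_zero, Nat.zero_mul, Nat.mul_one, Nat.one_mul, h24, h25, h26, h27, h30, h39, hl] at hv9 hR; subst hv9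
    have htmp := execOps_cons_fwd hR; clear hR; obtain ⟨v10, hv10, hR⟩ := htmp
    simp -failIfUnchanged (disch := omega) only [Operand.write, Operand.read, merge_apply_of_lt,
      merge_apply_of_le, Function.update_self, Function.update_of_ne, update_merge_of_lt,
      update_merge_of_le, Nat.add_zero, Nat.zero_add, BinOp.eval_mod, BinOp.eval_eq, BinOp.eval_band,
      BinOp.eval_shr, BinOp.eval_div, BinOp.eval_lt, BinOp.eval_add_of_lt, BinOp.eval_sub_of_le,
      BinOp.eval_mul_of_lt, Nat.sub_self, Nat.sub_zero, Nat.mul_zero, Nat.zero_mul, Nat.mul_one, Nat.one_mul, h24, h25, h26, h27, h30, h39, hl] at hv10 hR; subst hv10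
    simp only [execOps_nil] at hR; subst hR
    refine ⟨_, rfl, fun q hq => ?_, ?_, ?_, ?_, ?_⟩
    · simp only [Function.update_of_ne (show q ≠ 24 by omega), Function.update_of_ne (show q ≠ 25 by omega), Function.update_of_ne (show q ≠ 26 by omega), Function.update_of_ne (show q ≠ 27 by omega), Function.update_of_ne (show q ≠ 40 by omega), Function.update_of_ne (show q ≠ 41 by omega), Function.update_of_ne (show q ≠ 42 by omega)]
    all_goals simp only [Function.update_self, Function.update_of_ne, ne_eq, Nat.reduceEqDiff,
      not_false_eq_true]
    all_goals omega
  obtain ⟨S', hR, hag, h24', h25', h26', h27'⟩ := step _ rfl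
  exact ⟨S', Exec.block' selOps qs hR, hag, by rw [h24', bsel, hl], by rw [h25', bsel, hl], h26', h27'⟩

/-- **One iteration of the inner loop** (row `r`, entry `j < N`): from `IRegs r j` to
`IRegs r (j + 1)` in `22` steps, the layout and outer registers unchanged. [folklore] -/
theorem innerBody_spec (hRg : Regs N A Hf S) {r j : ℕ} (hr : r < N) (hj : j < N) (hO : ORegs cd N A Hf r S)
    (hI : IRegs cd N A Hf r j S) (hH : ∀ t, t < N * N → H (pR N + 2 + t) = cd t)
    (hcd : ∀ t, cd t ≤ CB) (hCB : CB ≤ Hf) (hHf : 2 * Hf ≤ A) (hw : 1 ≤ w) (hA : 2 ^ w - 1 = A)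
    (hHfA : A / 2 = Hf) (hF : pTop N < 2 ^ w) (qs : List (List ℕ)) :
    ∃ S', Exec w O innerBody ⟨merge S H, qs⟩ ⟨merge S' H, qs⟩ 22 ∧ Regs N A Hf S' ∧ ORegs cd N A Hf r S' ∧
      IRegs cd N A Hf r (j + 1) S' := by
  have hRR : pR N = 2 * (N * N) + 103 := rfl
  have hT : pTop N = 3 * (N * N) + 107 := rfl
  have hAw : A < 2 ^ w := by omega
  have hrN : r * N + N ≤ N * N := by
    have := Nat.mul_le_mul_right N (Nat.succ_le_of_lt hr); rwa [Nat.succ_mul] at this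
  have hcdHf : ∀ t, cd t ≤ Hf := fun t => (hcd t).trans hCB
  obtain ⟨S₁, hex₁, hag₁, h30, h39⟩ := keyOps_spec hRg hr hj hI.r27 hH hcd hCB hHf hw hA hHfA hF qs
  obtain ⟨hb1, hb2⟩ := rowSt_le (N := N) hcdHf hHf r j
  obtain ⟨S₂, hex₂, hag₂, h24, h25, h26, h27⟩ := selOps_spec (S := S₁) (H := H)
    ((hag₁ 24 (by norm_num)).trans hI.r24) ((hag₁ 25 (by norm_num)).trans hI.r25) h30 h39 hj
    ((hag₁ 26 (by norm_num)).trans hI.r26) ((hag₁ 27 (by norm_num)).trans hI.r27) hb1 hb2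
    ((hcdHf _).trans (by omega)) (keyOf_le (hcdHf _) hHf) hAw hF (by omega) qs
  refine ⟨S₂, ?_, hRg.of_agree fun q hq => ?_, hO.of_agree fun q hq1 hq2 => ?_, ⟨?_, ?_, h26, ?_⟩⟩
  · exact Exec.seqs_cons hex₁ (Exec.seqs_one hex₂)
  · rw [hag₂ q (by omega), hag₁ q (by omega)]
  · rw [hag₂ q (by omega), hag₁ q (by omega)]
  · rw [h24, rowSt]
  · rw [h25, rowSt]
  · rw [h27]; ring

/-- **Semantics of the inner loop** over row `r`: from `IRegs r 0`, `N` iterations reach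
`IRegs r N` within `24 N + 1` steps. [folklore] -/
theorem innerLoop_spec (hRg : Regs N A Hf S) {r : ℕ} (hr : r < N) (hO : ORegs cd N A Hf r S)
    (hI : IRegs cd N A Hf r 0 S) (hH : ∀ t, t < N * N → H (pR N + 2 + t) = cd t)
    (hcd : ∀ t, cd t ≤ CB) (hCB : CB ≤ Hf) (hHf : 2 * Hf ≤ A) (hw : 1 ≤ w) (hA : 2 ^ w - 1 = A)
    (hHfA : A / 2 = Hf) (hF : pTop N < 2 ^ w) (qs : List (List ℕ)) :
    ∃ S', ExecLE w O (whilenz (.dir 26) innerBody) ⟨merge S H, qs⟩ ⟨merge S' H, qs⟩ (N * 24 + 1) ∧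
      Regs N A Hf S' ∧ ORegs cd N A Hf r S' ∧ IRegs cd N A Hf r N S' := by
  have h0 : (fun j (st : Store) => ∃ S₀, st = ⟨merge S₀ H, qs⟩ ∧ Regs N A Hf S₀ ∧ ORegs cd N A Hf r S₀ ∧
      IRegs cd N A Hf r j S₀) 0 ⟨merge S H, qs⟩ := ⟨S, rfl, hRg, hO, hI⟩
  obtain ⟨st', hex, S', hst, hRg', hO', hI'⟩ :=
    ExecLE.whilenz_invariant (w := w) (O := O) (x := .dir 26) (s := innerBody) N 22
      (fun j st => ∃ S₀, st = ⟨merge S₀ H, qs⟩ ∧ Regs N A Hf S₀ ∧ ORegs cd N A Hf r S₀ ∧ IRegs cd N A Hf r j S₀)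
      (fun j hj st hst => by
        obtain ⟨S₀, rfl, hRg₀, hO₀, hI₀⟩ := hst
        refine ⟨by rw [Operand.read_dir_merge (by decide), hI₀.r26]; omega, ?_⟩
        obtain ⟨S₁, hex, hRg₁, hO₁, hI₁⟩ := innerBody_spec hRg₀ hr hj hO₀ hI₀ hH hcd hCB hHf hw hA hHfA hF qs
        exact ⟨_, hex.execLE, S₁, rfl, hRg₁, hO₁, hI₁⟩)
      (fun st hst => by
        obtain ⟨S₀, rfl, -, -, hI₀⟩ := hst
        rw [Operand.read_dir_merge (by decide), hI₀.r26]; omega)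
      h0
  subst hst
  exact ⟨S', hex, hRg', hO', hI'⟩

end inner

/-! ## The outer loop -/

section outer

variable {cd : ℕ → ℕ} {A Hf CB : ℕ} {S H : ℕ → ℕ}

-- The symbolic execution below uses one uniform `simp only` read-normaliser per instruction;
-- not every lemma of the set fires at every instruction.
set_option linter.unusedSimpArgs false in
/-- **Opening a row**: `IRegs r 0` (running maximum `(0, 0)`, `N` entries to go, entry pointer at
the row start). [folklore] -/
theorem outerPre_spec (hRg : Regs N A Hf S) {r : ℕ} (hr : r < N) (hO : ORegs cd N A Hf r S)
    (hF : pTop N < 2 ^ w) (qs : List (List ℕ)) :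
    ∃ S', Exec w O (block outerPre) ⟨merge S H, qs⟩ ⟨merge S' H, qs⟩ 4 ∧ Regs N A Hf S' ∧ ORegs cd N A Hf r S' ∧
      IRegs cd N A Hf r 0 S' := by
  have hRR : pR N = 2 * (N * N) + 103 := rfl
  have hT : pTop N = 3 * (N * N) + 107 := rfl
  have hNN : N ≤ N * N := Nat.le_mul_self N
  have hrN : r * N + N ≤ N * N := by
    have := Nat.mul_le_mul_right N (Nat.succ_le_of_lt hr); rwa [Nat.succ_mul] at this
  have h2 := hRg.r2
  have h21 := hO.r21
  have step : ∀ R, execOps w (merge S H) outerPre = R →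
      ∃ S', R = merge S' H ∧ (∀ q, q ≤ 23 → S' q = S q) ∧ S' 24 = 0 ∧ S' 25 = 0 ∧ S' 26 = N ∧
        S' 27 = pR N + 2 + r * N := by
    intro R hR
    unfold outerPre at hR
    have htmp := execOps_cons_fwd hR; clear hR; obtain ⟨v1, hv1, hR⟩ := htmp
    simp -failIfUnchanged (disch := omega) only [Operand.write, Operand.read, merge_apply_of_lt,
      merge_apply_of_le, Function.update_self, Function.update_of_ne, update_merge_of_lt,
      update_merge_of_le, Nat.add_zero, Nat.zero_add, BinOp.eval_mod, BinOp.eval_eq, BinOp.eval_band,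
      BinOp.eval_shr, BinOp.eval_div, BinOp.eval_lt, BinOp.eval_add_of_lt, BinOp.eval_sub_of_le,
      BinOp.eval_mul_of_lt, h2, h21] at hv1 hR; subst hv1
    have htmp := execOps_cons_fwd hR; clear hR; obtain ⟨v2, hv2, hR⟩ := htmp
    simp -failIfUnchanged (disch := omega) only [Operand.write, Operand.read, merge_apply_of_lt,
      merge_apply_of_le, Function.update_self, Function.update_of_ne, update_merge_of_lt,
      update_merge_of_le, Nat.add_zero, Nat.zero_add, BinOp.eval_mod, BinOp.eval_eq, BinOp.eval_band,
      BinOp.eval_shr, BinOp.eval_div, BinOp.eval_lt, BinOp.eval_add_of_lt, BinOp.eval_sub_of_le,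
      BinOp.eval_mul_of_lt, h2, h21] at hv2 hR; subst hv2
    have htmp := execOps_cons_fwd hR; clear hR; obtain ⟨v3, hv3, hR⟩ := htmp
    simp -failIfUnchanged (disch := omega) only [Operand.write, Operand.read, merge_apply_of_lt,
      merge_apply_of_le, Function.update_self, Function.update_of_ne, update_merge_of_lt,
      update_merge_of_le, Nat.add_zero, Nat.zero_add, BinOp.eval_mod, BinOp.eval_eq, BinOp.eval_band,
      BinOp.eval_shr, BinOp.eval_div, BinOp.eval_lt, BinOp.eval_add_of_lt, BinOp.eval_sub_of_le,
      BinOp.eval_mul_of_lt, h2, h21] at hv3 hR; subst hv3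
    have htmp := execOps_cons_fwd hR; clear hR; obtain ⟨v4, hv4, hR⟩ := htmp
    simp -failIfUnchanged (disch := omega) only [Operand.write, Operand.read, merge_apply_of_lt,
      merge_apply_of_le, Function.update_self, Function.update_of_ne, update_merge_of_lt,
      update_merge_of_le, Nat.add_zero, Nat.zero_add, BinOp.eval_mod, BinOp.eval_eq, BinOp.eval_band,
      BinOp.eval_shr, BinOp.eval_div, BinOp.eval_lt, BinOp.eval_add_of_lt, BinOp.eval_sub_of_le,
      BinOp.eval_mul_of_lt, h2, h21] at hv4 hR; subst hv4
    simp only [execOps_nil] at hR; subst hR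
    refine ⟨_, rfl, fun q hq => ?_, ?_, ?_, ?_, ?_⟩
    · simp only [Function.update_of_ne (show q ≠ 24 by omega), Function.update_of_ne (show q ≠ 25 by omega), Function.update_of_ne (show q ≠ 26 by omega), Function.update_of_ne (show q ≠ 27 by omega)]
    all_goals simp only [Function.update_self, Function.update_of_ne, ne_eq, Nat.reduceEqDiff,
      not_false_eq_true]
  obtain ⟨S', hR, hag, h24, h25, h26, h27⟩ := step _ rfl
  refine ⟨S', Exec.block' outerPre qs hR, hRg.of_agree fun q hq => hag q (by omega),
    hO.of_agree fun q _ hq => hag q hq, ⟨?_, ?_, ?_, ?_⟩⟩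
  · rw [h24, rowSt]
  · rw [h25, rowSt]
  · rw [h26]; omega
  · rw [h27]; omega

-- The symbolic execution below uses one uniform `simp only` read-normaliser per instruction;
-- not every lemma of the set fires at every instruction.
set_option linter.unusedSimpArgs false in
/-- **Closing a row**: fold the row maximum `(r24, r25) = rowSt r N` into the running minimum
(`ORegs (r + 1)`), advance the row pointer, count down the rows. [folklore] -/
theorem outerPost_spec (hRg : Regs N A Hf S) {r : ℕ} (hr : r < N) (hO : ORegs cd N A Hf r S)
    (hI : IRegs cd N A Hf r N S) (hcd : ∀ t, cd t ≤ CB) (hCB : CB ≤ Hf) (hHf : 2 * Hf ≤ A)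
    (hAw : A < 2 ^ w) (hF : pTop N < 2 ^ w) (qs : List (List ℕ)) :
    ∃ S', Exec w O (block outerPost) ⟨merge S H, qs⟩ ⟨merge S' H, qs⟩ 10 ∧ Regs N A Hf S' ∧
      ORegs cd N A Hf (r + 1) S' := by
  have hRR : pR N = 2 * (N * N) + 103 := rfl
  have hT : pTop N = 3 * (N * N) + 107 := rfl
  have hNN : N ≤ N * N := Nat.le_mul_self N
  have hrN : r * N + N ≤ N * N := by
    have := Nat.mul_le_mul_right N (Nat.succ_le_of_lt hr); rwa [Nat.succ_mul] at this
  have hcdHf : ∀ t, cd t ≤ Hf := fun t => (hcd t).trans hCB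
  obtain ⟨mn, hmn⟩ : ∃ mn, (minSt cd A Hf N r).1 = mn := ⟨_, rfl⟩
  obtain ⟨mc, hmc⟩ : ∃ mc, (minSt cd A Hf N r).2 = mc := ⟨_, rfl⟩
  obtain ⟨mx, hmx⟩ : ∃ mx, (rowSt cd A Hf N r N).1 = mx := ⟨_, rfl⟩
  obtain ⟨xc, hxc⟩ : ∃ xc, (rowSt cd A Hf N r N).2 = xc := ⟨_, rfl⟩
  obtain ⟨hb1, hb2⟩ := minSt_le (N := N) hcdHf hHf r
  obtain ⟨hb3, hb4⟩ := rowSt_le (N := N) hcdHf hHf r N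
  rw [hmn] at hb1; rw [hmc] at hb2; rw [hmx] at hb3; rw [hxc] at hb4
  have h2 := hRg.r2
  have h20 := hO.r20
  have h21 := hO.r21
  have h22 : S 22 = mn := hO.r22.trans hmn
  have h23 : S 23 = mc := hO.r23.trans hmc
  have h24 : S 24 = mx := hI.r24.trans hmx
  have h25 : S 25 = xc := hI.r25.trans hxc
  obtain ⟨l, hl⟩ : ∃ l, (if mx < mn then 1 else 0) = l := ⟨_, rfl⟩
  have hl1 : l ≤ 1 := by rw [← hl]; exact ite_le_one _
  obtain ⟨hm1, hm2⟩ := mul_ind_le hl1 mn mx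
  obtain ⟨hm3, hm4⟩ := mul_ind_le hl1 mc xc
  have hs1 : mn * (1 - l) + mx * l ≤ A := bsel_le hl1 hb1 hb3
  have hs2 : mc * (1 - l) + xc * l ≤ A := bsel_le hl1 hb2 hb4
  have step : ∀ R, execOps w (merge S H) outerPost = R →
      ∃ S', R = merge S' H ∧ (∀ q, q ≤ 9 → S' q = S q) ∧ S' 20 = N - (r + 1) ∧
        S' 21 = pR N + 2 + (r + 1) * N ∧ S' 22 = mn * (1 - l) + mx * l ∧ S' 23 = mc * (1 - l) + xc * l := by
    intro R hR
    unfold outerPost at hR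
    have htmp := execOps_cons_fwd hR; clear hR; obtain ⟨v1, hv1, hR⟩ := htmp
    simp -failIfUnchanged (disch := omega) only [Operand.write, Operand.read, merge_apply_of_lt,
      merge_apply_of_le, Function.update_self, Function.update_of_ne, update_merge_of_lt,
      update_merge_of_le, Nat.add_zero, Nat.zero_add, BinOp.eval_mod, BinOp.eval_eq, BinOp.eval_band,
      BinOp.eval_shr, BinOp.eval_div, BinOp.eval_lt, BinOp.eval_add_of_lt, BinOp.eval_sub_of_le,
      BinOp.eval_mul_of_lt, Nat.sub_self, Nat.sub_zero, Nat.mul_zero, Nat.zero_mul, Nat.mul_one, Nat.one_mul, h2, h20, h21, h22, h23, h24, h25, hl] at hv1 hR; subst hv1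
    have htmp := execOps_cons_fwd hR; clear hR; obtain ⟨v2, hv2, hR⟩ := htmp
    simp -failIfUnchanged (disch := omega) only [Operand.write, Operand.read, merge_apply_of_lt,
      merge_apply_of_le, Function.update_self, Function.update_of_ne, update_merge_of_lt,
      update_merge_of_le, Nat.add_zero, Nat.zero_add, BinOp.eval_mod, BinOp.eval_eq, BinOp.eval_band,
      BinOp.eval_shr, BinOp.eval_div, BinOp.eval_lt, BinOp.eval_add_of_lt, BinOp.eval_sub_of_le,
      BinOp.eval_mul_of_lt, Nat.sub_self, Nat.sub_zero, Nat.mul_zero, Nat.zero_mul, Nat.mul_one, Nat.one_mul, h2, h20, h21, h22, h23, h24, h25, hl] at hv2 hR; subst hv2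
    have htmp := execOps_cons_fwd hR; clear hR; obtain ⟨v3, hv3, hR⟩ := htmp
    simp -failIfUnchanged (disch := omega) only [Operand.write, Operand.read, merge_apply_of_lt,
      merge_apply_of_le, Function.update_self, Function.update_of_ne, update_merge_of_lt,
      update_merge_of_le, Nat.add_zero, Nat.zero_add, BinOp.eval_mod, BinOp.eval_eq, BinOp.eval_band,
      BinOp.eval_shr, BinOp.eval_div, BinOp.eval_lt, BinOp.eval_add_of_lt, BinOp.eval_sub_of_le,
      BinOp.eval_mul_of_lt, Nat.sub_self, Nat.sub_zero, Nat.mul_zero, Nat.zero_mul, Nat.mul_one, Nat.one_mul, h2, h20, h21, h22, h23, h24, h25, hl] at hv3 hR; subst hv3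
    have htmp := execOps_cons_fwd hR; clear hR; obtain ⟨v4, hv4, hR⟩ := htmp
    simp -failIfUnchanged (disch := omega) only [Operand.write, Operand.read, merge_apply_of_lt,
      merge_apply_of_le, Function.update_self, Function.update_of_ne, update_merge_of_lt,
      update_merge_of_le, Nat.add_zero, Nat.zero_add, BinOp.eval_mod, BinOp.eval_eq, BinOp.eval_band,
      BinOp.eval_shr, BinOp.eval_div, BinOp.eval_lt, BinOp.eval_add_of_lt, BinOp.eval_sub_of_le,
      BinOp.eval_mul_of_lt, Nat.sub_self, Nat.sub_zero, Nat.mul_zero, Nat.zero_mul, Nat.mul_one, Nat.one_mul, h2, h20, h21, h22, h23, h24, h25, hl] at hv4 hR; subst hv4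
    have htmp := execOps_cons_fwd hR; clear hR; obtain ⟨v5, hv5, hR⟩ := htmp
    simp -failIfUnchanged (disch := omega) only [Operand.write, Operand.read, merge_apply_of_lt,
      merge_apply_of_le, Function.update_self, Function.update_of_ne, update_merge_of_lt,
      update_merge_of_le, Nat.add_zero, Nat.zero_add, BinOp.eval_mod, BinOp.eval_eq, BinOp.eval_band,
      BinOp.eval_shr, BinOp.eval_div, BinOp.eval_lt, BinOp.eval_add_of_lt, BinOp.eval_sub_of_le,
      BinOp.eval_mul_of_lt, Nat.sub_self, Nat.sub_zero, Nat.mul_zero, Nat.zero_mul, Nat.mul_one, Nat.one_mul, h2, h20, h21, h22, h23, h24, h25, hl] at hv5 hR; subst hv5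
    have htmp := execOps_cons_fwd hR; clear hR; obtain ⟨v6, hv6, hR⟩ := htmp
    simp -failIfUnchanged (disch := omega) only [Operand.write, Operand.read, merge_apply_of_lt,
      merge_apply_of_le, Function.update_self, Function.update_of_ne, update_merge_of_lt,
      update_merge_of_le, Nat.add_zero, Nat.zero_add, BinOp.eval_mod, BinOp.eval_eq, BinOp.eval_band,
      BinOp.eval_shr, BinOp.eval_div, BinOp.eval_lt, BinOp.eval_add_of_lt, BinOp.eval_sub_of_le,
      BinOp.eval_mul_of_lt, Nat.sub_self, Nat.sub_zero, Nat.mul_zero, Nat.zero_mul, Nat.mul_one, Nat.one_mul, h2, h20, h21, h22, h23, h24, h25, hl] at hv6 hR; subst hv6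
    have htmp := execOps_cons_fwd hR; clear hR; obtain ⟨v7, hv7, hR⟩ := htmp
    simp -failIfUnchanged (disch := omega) only [Operand.write, Operand.read, merge_apply_of_lt,
      merge_apply_of_le, Function.update_self, Function.update_of_ne, update_merge_of_lt,
      update_merge_of_le, Nat.add_zero, Nat.zero_add, BinOp.eval_mod, BinOp.eval_eq, BinOp.eval_band,
      BinOp.eval_shr, BinOp.eval_div, BinOp.eval_lt, BinOp.eval_add_of_lt, BinOp.eval_sub_of_le,
      BinOp.eval_mul_of_lt, Nat.sub_self, Nat.sub_zero, Nat.mul_zero, Nat.zero_mul, Nat.mul_one, Nat.one_mul, h2, h20, h21, h22, h23, h24, h25, hl] at hv7 hR; subst hv7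
    have htmp := execOps_cons_fwd hR; clear hR; obtain ⟨v8, hv8, hR⟩ := htmp
    simp -failIfUnchanged (disch := omega) only [Operand.write, Operand.read, merge_apply_of_lt,
      merge_apply_of_le, Function.update_self, Function.update_of_ne, update_merge_of_lt,
      update_merge_of_le, Nat.add_zero, Nat.zero_add, BinOp.eval_mod, BinOp.eval_eq, BinOp.eval_band,
      BinOp.eval_shr, BinOp.eval_div, BinOp.eval_lt, BinOp.eval_add_of_lt, BinOp.eval_sub_of_le,
      BinOp.eval_mul_of_lt, Nat.sub_self, Nat.sub_zero, Nat.mul_zero, Nat.zero_mul, Nat.mul_one, Nat.one_mul, h2, h20, h21, h22, h23, h24, h25, hl] at hv8 hR; subst hv8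
    have htmp := execOps_cons_fwd hR; clear hR; obtain ⟨v9, hv9, hR⟩ := htmp
    simp -failIfUnchanged (disch := omega) only [Operand.write, Operand.read, merge_apply_of_lt,
      merge_apply_of_le, Function.update_self, Function.update_of_ne, update_merge_of_lt,
      update_merge_of_le, Nat.add_zero, Nat.zero_add, BinOp.eval_mod, BinOp.eval_eq, BinOp.eval_band,
      BinOp.eval_shr, BinOp.eval_div, BinOp.eval_lt, BinOp.eval_add_of_lt, BinOp.eval_sub_of_le,
      BinOp.eval_mul_of_lt, Nat.sub_self, Nat.sub_zero, Nat.mul_zero, Nat.zero_mul, Nat.mul_one, Nat.one_mul, h2, h20, h21, h22, h23, h24, h25, hl] at hv9 hR; subst hv9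
    have htmp := execOps_cons_fwd hR; clear hR; obtain ⟨v10, hv10, hR⟩ := htmp
    simp -failIfUnchanged (disch := omega) only [Operand.write, Operand.read, merge_apply_of_lt,
      merge_apply_of_le, Function.update_self, Function.update_of_ne, update_merge_of_lt,
      update_merge_of_le, Nat.add_zero, Nat.zero_add, BinOp.eval_mod, BinOp.eval_eq, BinOp.eval_band,
      BinOp.eval_shr, BinOp.eval_div, BinOp.eval_lt, BinOp.eval_add_of_lt, BinOp.eval_sub_of_le,
      BinOp.eval_mul_of_lt, Nat.sub_self, Nat.sub_zero, Nat.mul_zero, Nat.zero_mul, Nat.mul_one, Nat.one_mul, h2, h20, h21, h22, h23, h24, h25, hl] at hv10 hR; subst hv10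
    simp only [execOps_nil] at hR; subst hR
    refine ⟨_, rfl, fun q hq => ?_, ?_, ?_, ?_, ?_⟩
    · simp only [Function.update_of_ne (show q ≠ 20 by omega), Function.update_of_ne (show q ≠ 21 by omega), Function.update_of_ne (show q ≠ 22 by omega), Function.update_of_ne (show q ≠ 23 by omega), Function.update_of_ne (show q ≠ 40 by omega), Function.update_of_ne (show q ≠ 41 by omega), Function.update_of_ne (show q ≠ 42 by omega)]
    all_goals simp only [Function.update_self, Function.update_of_ne, ne_eq, Nat.reduceEqDiff,
      not_false_eq_true]
    · omega
    · rw [Nat.succ_mul]; omega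
  obtain ⟨S', hR, hag, h20', h21', h22', h23'⟩ := step _ rfl
  refine ⟨S', Exec.block' outerPost qs hR, hRg.of_agree hag, ⟨h20', h21', ?_, ?_⟩⟩
  · rw [h22', minSt, hmn, hmx, hl]; rfl
  · rw [h23', minSt, hmn, hmc, hmx, hxc, hl]; rfl

/-- **One iteration of the outer loop** (row `r < N`): from `ORegs r` to `ORegs (r + 1)` within
`24 N + 15` steps. [folklore] -/
theorem outerBody_spec (hRg : Regs N A Hf S) {r : ℕ} (hr : r < N) (hO : ORegs cd N A Hf r S)
    (hH : ∀ t, t < N * N → H (pR N + 2 + t) = cd t) (hcd : ∀ t, cd t ≤ CB) (hCB : CB ≤ Hf)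
    (hHf : 2 * Hf ≤ A) (hw : 1 ≤ w) (hA : 2 ^ w - 1 = A) (hHfA : A / 2 = Hf) (hF : pTop N < 2 ^ w)
    (qs : List (List ℕ)) :
    ∃ S', ExecLE w O outerBody ⟨merge S H, qs⟩ ⟨merge S' H, qs⟩ (N * 24 + 15) ∧ Regs N A Hf S' ∧
      ORegs cd N A Hf (r + 1) S' := by
  have hAw : A < 2 ^ w := by have hT : pTop N = 3 * (N * N) + 107 := rfl; omega
  obtain ⟨S₁, hex₁, hRg₁, hO₁, hI₁⟩ := outerPre_spec (O := O) (cd := cd) (H := H) hRg hr hO hF qs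
  obtain ⟨S₂, hex₂, hRg₂, hO₂, hI₂⟩ := innerLoop_spec (O := O) hRg₁ hr hO₁ hI₁ hH hcd hCB hHf hw hA hHfA hF qs
  obtain ⟨S₃, hex₃, hRg₃, hO₃⟩ := outerPost_spec (O := O) (H := H) hRg₂ hr hO₂ hI₂ hcd hCB hHf hAw hF qs
  refine ⟨S₃, ?_, hRg₃, hO₃⟩
  have := hex₁.execLE.seqs_cons (hex₂.seqs_cons (ExecLE.seqs_one hex₃.execLE))
  exact this.mono (by omega)

/-- **Semantics of the outer loop**: from `ORegs 0`, `N` rows are folded within `N (24 N + 17) + 1`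
steps, reaching `ORegs N` (the registers `22, 23` hold `minSt N`). [folklore] -/
theorem outerLoop_spec (hRg : Regs N A Hf S) (hO : ORegs cd N A Hf 0 S)
    (hH : ∀ t, t < N * N → H (pR N + 2 + t) = cd t) (hcd : ∀ t, cd t ≤ CB) (hCB : CB ≤ Hf)
    (hHf : 2 * Hf ≤ A) (hw : 1 ≤ w) (hA : 2 ^ w - 1 = A) (hHfA : A / 2 = Hf) (hF : pTop N < 2 ^ w)
    (qs : List (List ℕ)) :
    ∃ S', ExecLE w O (whilenz (.dir 20) outerBody) ⟨merge S H, qs⟩ ⟨merge S' H, qs⟩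
        (N * (N * 24 + 15 + 2) + 1) ∧ Regs N A Hf S' ∧ ORegs cd N A Hf N S' := by
  have h0 : (fun r (st : Store) => ∃ S₀, st = ⟨merge S₀ H, qs⟩ ∧ Regs N A Hf S₀ ∧ ORegs cd N A Hf r S₀)
      0 ⟨merge S H, qs⟩ := ⟨S, rfl, hRg, hO⟩
  obtain ⟨st', hex, S', hst, hRg', hO'⟩ :=
    ExecLE.whilenz_invariant (w := w) (O := O) (x := .dir 20) (s := outerBody) N (N * 24 + 15)
      (fun r st => ∃ S₀, st = ⟨merge S₀ H, qs⟩ ∧ Regs N A Hf S₀ ∧ ORegs cd N A Hf r S₀)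
      (fun r hr st hst => by
        obtain ⟨S₀, rfl, hRg₀, hO₀⟩ := hst
        refine ⟨by rw [Operand.read_dir_merge (by decide), hO₀.r20]; omega, ?_⟩
        obtain ⟨S₁, hex, hRg₁, hO₁⟩ := outerBody_spec hRg₀ hr hO₀ hH hcd hCB hHf hw hA hHfA hF qs
        exact ⟨_, hex, S₁, rfl, hRg₁, hO₁⟩)
      (fun st hst => by
        obtain ⟨S₀, rfl, -, hO₀⟩ := hst
        rw [Operand.read_dir_merge (by decide), hO₀.r20]; omega)
      h0
  subst hst
  exact ⟨S', hex, hRg', hO'⟩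

end outer

/-! ## The finish and the whole run -/

-- The symbolic execution below uses one uniform `simp only` read-normaliser per instruction;
-- not every lemma of the set fires at every instruction.
set_option linter.unusedSimpArgs false in
/-- **The finish**: `mem[1] := r23`, `mem[0] := 1`. [folklore] -/
theorem finish_spec {S : ℕ → ℕ} (H : ℕ → ℕ) {mc : ℕ} (h23 : S 23 = mc) (hmc : mc < 2 ^ w)
    (hF : pTop N < 2 ^ w) (qs : List (List ℕ)) :
    ∃ S', Exec w O (block finishOps) ⟨merge S H, qs⟩ ⟨merge S' H, qs⟩ 2 ∧ S' 0 = 1 ∧ S' 1 = mc := by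
  have hT : pTop N = 3 * (N * N) + 107 := rfl
  have step : ∀ R, execOps w (merge S H) finishOps = R → ∃ S', R = merge S' H ∧ S' 0 = 1 ∧ S' 1 = mc := by
    intro R hR
    unfold finishOps at hR
    have htmp := execOps_cons_fwd hR; clear hR; obtain ⟨v1, hv1, hR⟩ := htmp
    simp -failIfUnchanged (disch := omega) only [Operand.write, Operand.read, merge_apply_of_lt,
      merge_apply_of_le, Function.update_self, Function.update_of_ne, update_merge_of_lt,
      update_merge_of_le, Nat.add_zero, Nat.zero_add, BinOp.eval_mod, BinOp.eval_eq, BinOp.eval_band,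
      BinOp.eval_shr, BinOp.eval_div, BinOp.eval_lt, BinOp.eval_add_of_lt, BinOp.eval_sub_of_le,
      BinOp.eval_mul_of_lt, h23] at hv1 hR; subst hv1
    have htmp := execOps_cons_fwd hR; clear hR; obtain ⟨v2, hv2, hR⟩ := htmp
    simp -failIfUnchanged (disch := omega) only [Operand.write, Operand.read, merge_apply_of_lt,
      merge_apply_of_le, Function.update_self, Function.update_of_ne, update_merge_of_lt,
      update_merge_of_le, Nat.add_zero, Nat.zero_add, BinOp.eval_mod, BinOp.eval_eq, BinOp.eval_band,
      BinOp.eval_shr, BinOp.eval_div, BinOp.eval_lt, BinOp.eval_add_of_lt, BinOp.eval_sub_of_le,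
      BinOp.eval_mul_of_lt, h23] at hv2 hR; subst hv2
    simp only [execOps_nil] at hR; subst hR
    refine ⟨_, rfl, ?_, ?_⟩ <;>
      simp only [Function.update_self, Function.update_of_ne, ne_eq, Nat.reduceEqDiff, not_false_eq_true]
  obtain ⟨S', hR, h⟩ := step _ rfl
  exact ⟨S', Exec.block' finishOps qs hR, h⟩

/-- The code table of an oracle answer `ans` (`L`, `N`, then the codes): `cd t = ans[t + 1]`.
[folklore] -/
def cdOf (ans : List ℕ) (t : ℕ) : ℕ := ans.getD (t + 1) 0

/-- **Semantics of the program.** On `⌜W⌝`, at a word size `w ≥ 1` accommodating the input and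
`pTop N`, and for an oracle whose answer to the input has `N² + 1` words, all `≤ CB` with
`CB ≤ Hf = A / 2`, `A = 2 ^ w - 1`: `prog` ends within `31 N² + 17 N + 23` steps with `mem 0 = 1`
and `mem 1 = (minSt (cdOf answer) A Hf N N).2`, having made the single query `⌜W⌝`. [folklore] -/
theorem prog_spec {A Hf CB : ℕ} (hwid : inputWidth (inp W) ≤ w) (hw : 1 ≤ w) (hA : 2 ^ w - 1 = A)
    (hHfA : A / 2 = Hf) (hF : pTop N < 2 ^ w) (hlen : (O (inp W)).length = N * N + 1)
    (hans : ∀ v ∈ O (inp W), v ≤ CB) (hCB : CB ≤ Hf) :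
    ∃ st' : Store, ExecLE w O prog ⟨(init w (inp W)).mem, []⟩ st' (31 * (N * N) + 17 * N + 23) ∧
      st'.queries = [inp W] ∧ st'.mem 0 = 1 ∧ st'.mem 1 = (minSt (cdOf (O (inp W))) A Hf N N).2 := by
  have hRR : pR N = 2 * (N * N) + 103 := rfl
  have hT : pTop N = 3 * (N * N) + 107 := rfl
  have hAw : A < 2 ^ w := by omega
  have hHf : 2 * Hf ≤ A := by omega
  set ans := O (inp W) with hans_def
  have hcd : ∀ t, cdOf ans t ≤ CB := fun t => by
    unfold cdOf
    rw [List.getD_eq_getElem?_getD]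
    cases h : ans[t + 1]? with
    | none => simp
    | some v => simpa using hans v (List.mem_of_getElem? h)
  -- relocate
  have hx : ∀ v ∈ inp W, v < 2 ^ w := fun v hv =>
    lt_of_lt_of_le (lt_two_pow_inputWidth_of_mem _ _ hv) (Nat.pow_le_pow_right Nat.two_pos hwid)
  have hrel := relocate_exec (w := w) (O := O) (x := inp W) (by rw [inp_length]; omega) hx
    (by rw [inp_length]; omega) []
  rw [← init_mem_eq_initFun hwid] at hrel
  -- setup
  obtain ⟨S₁, hex₁, hRg₁, hO₁⟩ := setup_spec (O := O) W (cdOf ans) hw hA hHfA hF []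
  rw [merge_self] at hex₁
  -- the query
  have hmap : ans.map (· % 2 ^ w) = ans := by
    rw [List.map_congr_left (fun v hv => Nat.mod_eq_of_lt (by have := hans v hv; omega)), List.map_id']
  have hexQ := Exec.query_dir (w := w) (O := O) (qa := 0) (ql := 4) (aa := 6) (by omega) (by omega)
    (by omega) (S := S₁) (by rw [hRg₁.r0]; omega) (by rw [hRg₁.r6]; omega) (relocated (inp W)) []
  rw [hRg₁.r0, hRg₁.r4, hRg₁.r6, readSeg_relocated, ← hans_def, hmap, List.nil_append] at hexQ
  -- the answer cells
  set H₅ := segWrite (relocated (inp W)) (pR N) ans with hH₅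
  have hH : ∀ t, t < N * N → H₅ (pR N + 2 + t) = cdOf ans t := fun t ht => by
    rw [hH₅]; unfold segWrite cdOf
    rw [if_neg (by omega), if_pos ⟨by omega, by rw [hlen]; omega⟩]
    congr 1; omega
  -- the fold
  obtain ⟨S₂, hex₂, hRg₂, hO₂⟩ := outerLoop_spec (H := H₅) hRg₁ hO₁ hH hcd hCB hHf hw hA hHfA hF [inp W]
  -- the finish
  obtain ⟨hm1, hm2⟩ := minSt_le (N := N) (fun t => (hcd t).trans hCB) hHf N
  obtain ⟨S₃, hex₃, h0, h1⟩ := finish_spec (O := O) H₅ hO₂.r23 (by omega) hF [inp W]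
  -- assemble
  have hexAll := hrel.execLE.seqs_cons (hex₁.execLE.seqs_cons (hexQ.execLE.seqs_cons
    (hex₂.seqs_cons (ExecLE.seqs_one hex₃.execLE))))
  refine ⟨_, hexAll.mono ?_, rfl, ?_, ?_⟩
  · rw [inp_length]; ring_nf; omega
  · show merge S₃ H₅ 0 = 1
    rw [merge_apply_of_lt (by norm_num), h0]
  · show merge S₃ H₅ 1 = _
    rw [merge_apply_of_lt (by norm_num), h1]

end semantics

end Literature.Computability.FineGrained.RadiusToAPSP
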